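import Literature.Analysis.FluidPDE.JiaSverak2013AprioriEstimateProofs
import Literature.Analysis.FluidPDE.JiaSverak2014SlabInitialLEI
import Literature.Analysis.FluidPDE.JiaSverak2014SlabPressureGauge
import Literature.Analysis.FluidPDE.LocalEnergyLimitBounds
import HarnessLib

/-!
# Jia–Šverák 2014, Lemma 3.1: the a priori estimate for Leray solutions **on a slab**

Analysis/FluidPDE proofs file (theorems only, no new definitions, no new named facts), part of
the proof of the named fact `Literature.Analysis.FluidPDE.jia_sverak_2014_theorem_3_2`
(`JiaSverak2014LocalRegularity.lean`; H. Jia, V. Šverák, Invent. Math. 196 (2014) =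
arXiv:1204.0529, §3 Thm. 3.2). The first input of the printed proof of Thm. 3.1/3.2 is
**Lemma 3.1** (arXiv p. 7, "(A priori estimate for Leray solution)"; = Jia–Šverák 2013, Lemma 2 =
Lemarié-Rieusset's a priori estimate): "Let `u₀ ∈ L²_loc` with `sup_{x₀} ∫_{B_R(x₀)} |u₀|² ≤ α`,
`u ∈ 𝒩(u₀)`; then for some absolute constants `c, C`, with `λ = c min{α⁻²R², 1}`,
`ess sup_{0≤t<λR²} sup_{x₀} ∫_{B_R(x₀)} |u|²/2 + sup_{x₀} ∫₀^{λR²}∫_{B_R(x₀)} |∇u|² +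
sup_{x₀} (∫₀^{λR²}∫_{B_R(x₀)} |p - c_{x₀}(t)|^{3/2})^{2/3} ≤ Cα`". The tree PROVES this for the
global-in-time class `𝒩(u₀)` (`JiaSverak2013.jia_sverak_2013_lemma_2_holds`,
`JiaSverak2013AprioriEstimateProofs.lean`). The fact `jia_sverak_2014_theorem_3_2` quantifies over
Leray solutions given on a finite slab `(0, T') × ℝ³` only (`IsLocalLeraySolutionOn T'`,
Lemarié-Rieusset 2016, Def. 14.1), which do not extend to `(0, ∞)`; this file therefore re-runs
the tree's proof of Lemma 2 at unit scale (`R = 1`, which is all Thm. 3.2 needs) for the slab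
class:

* `exists_lintegral_cube_window_le_slab`, `lintegral_window_pressure_le_slab`,
  `exists_window_flux_le_slab`, `exists_window_pressure_bound_slab` — the window estimates of
  the tree's proof from the raw hypotheses they use (measurability of `u, p` on `(0,S) × ℝ³`,
  `|u|³ ∈ L¹` on the boxes `(0,S) × B_ρ(y)`, a weak gradient on the slab `(0,S) × ℝ³`);
* `IsLocalLeraySolutionOn.sub_pressure` — renormalising the pressure by a measurable
  `L^{3/2}(0,T)` gauge keeps the slab class (the tree's `Seregin2014Limit.isSuitableWeakSolutionOn_sub_gauge`);
* `core_bounds_slab` — the discrete continuation argument on `(0, T)`, `T ≤ T_sl`, `T ≤ 1/2`;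
* `apriori_unit_scale_slab` — **Lemma 3.1 at `R = 1` for the slab class**: absolute `ε₀, C`
  such that for every measurable `u₀` with `sup_{x₀} ∫_{B_1(x₀)} |u₀|² ≤ 2α`, every local Leray
  solution `(u, p)` on `(0,T_sl) × ℝ³` with datum `u₀` and weak gradient `G`, and every
  `0 < T ≤ T_sl` with `T ≤ ε₀`, `Tα² ≤ ε₀`: unit-ball energies `≤ 2Cα` for a.e. `t ∈ (0,T)`,
  unit-ball dissipations on `(0,T)` `≤ Cα`, and gauged pressures
  `∫∫_{(0,T)×B_1(x₀)} |p - c|^{3/2} ≤ Cα^{3/2}`.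

The proofs are the tree's (`JiaSverak2013AprioriEstimateProofs.lean`, whose generic lemmas are
reused by name), with the class projections replaced by the slab ones: uniformly local bounds on
`(0, T_sl)` (instead of `(0, 1)`), the local energy inequality from `t = 0` for the slab class up
to the final time (`IsLocalLeraySolutionOn.ae_lintegral_sq_mul_add_grad_le_datum_add`,
`JiaSverak2014SlabInitialLEI.lean`), the slab gauges
(`IsLocalLeraySolutionOn.exists_measurable_gauge`, `JiaSverak2014SlabPressureGauge.lean`) and the
slab cubic integrability (`IsLocalLeraySolutionOn.lintegral_cube_box_lt_top`).

## Mathlib / tree search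

Tree: `JiaSverak2013.{exists_lintegral_cube_window_le, lintegral_window_pressure_le,
exists_window_flux_le, exists_window_pressure_bound, exists_measurable_gauge, core_bounds,
apriori_unit_scale}` (global class `IsLocalLeraySolution` only; `lean search 'apriori.*slab|
core_bounds|IsLocalLeraySolutionOn.*apriori'` finds no slab form); reused generic lemmas of that
file (`ae_restrict_Ioo_comp_add`, `exists_testFn_bounds`, `enorm_flux_le`, `exists_lattice_dist_lt`,
`setLIntegral_prod_le_of_ae`, `exists_window_small`, `small_hyps`, `window_bound_le_quarter`, …),
`exists_lintegral_cube_box_le_explicit`, `HasWeakSpatialGradientOn.timeShift`, `.ae_eq`,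
`Seregin2014Limit.isSuitableWeakSolutionOn_sub_gauge`, `stein1970_normalisedPressure_ae_Lp_bound_holds`.

## References

* H. Jia, V. Šverák, Invent. Math. 196 (2014) = arXiv:1204.0529, §3 **Lemma 3.1** (A priori
  estimate for Leray solution), p. 7. Bib key `JiaSverak2014`.
* H. Jia, V. Šverák, SIAM J. Math. Anal. 45 (2013) = arXiv:1201.1592, Lemma 2 with (2.7), (2.9)
  and its proof, pp. 3–4. Bib key `JiaSverak2013`.
* K. Kang, H. Miura, T.-P. Tsai, IMRN 2021 = arXiv:1812.10509, Lemmas 3.4–3.5, §8.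
  Bib key `KangMiuraTsai2020`.
* P. G. Lemarié-Rieusset, *The Navier–Stokes Problem in the 21st Century* (2016), Def. 14.1,
  Thm. 14.1. Bib key `LemarieRieusset2016`.
-/

noncomputable section

open MeasureTheory TopologicalSpace Set Function Filter Metric
open _root_.Topology
open scoped ENNReal NNReal RealInnerProductSpace Laplacian

namespace Literature.Analysis.FluidPDE

/-! ### Renormalising the pressure keeps the slab class -/

/-- **Renormalising the pressure of a local Leray solution on a slab by a function of time.**
If `(v, π)` is a local Leray solution on `(0,T) × ℝ³` and `c : ℝ → ℝ` is measurable, in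
`L^{3/2}(0,T)`, with `∫∫_{(0,T) × B_R} |π − c(t)|^{3/2} < ∞` for all `R > 0`, then `(v, π − c)`
is again a local Leray solution on the slab with the same datum (the pressure of a suitable weak
solution is determined up to functions of time, `Seregin2014Limit.isSuitableWeakSolutionOn_sub_gauge`;
Jia–Šverák 2014, §3 remark after Def. 3.1, the constant `c_{x₀,R}(t)`; the slab twin of
`IsLocalLeraySolution.sub_pressure`). [cite: JiaSverak2014, §3 remark after Def. 3.1 (arXiv p. 7)] -/
theorem IsLocalLeraySolutionOn.sub_pressure {T ν : ℝ}
    {v₀ : (EuclideanSpace ℝ (Fin 3)) → (EuclideanSpace ℝ (Fin 3))}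
    {v : ℝ → (EuclideanSpace ℝ (Fin 3)) → (EuclideanSpace ℝ (Fin 3))} {π : ℝ → (EuclideanSpace ℝ (Fin 3)) → ℝ}
    (h : IsLocalLeraySolutionOn T ν v₀ v π) {c : ℝ → ℝ} (hc : Measurable c)
    (hcL : MemLp c (3 / 2 : ℝ≥0∞) (volume.restrict (Ioo 0 T)))
    (hfin : ∀ R : ℝ, 0 < R →
      ∫⁻ z in Ioo 0 T ×ˢ ball (0 : (EuclideanSpace ℝ (Fin 3))) R, ‖π z.1 z.2 - c z.1‖ₑ ^ (3 / 2 : ℝ) < ∞) :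
    IsLocalLeraySolutionOn T ν v₀ v (fun t x => π t x - c t) := by
  -- `∫₀ᵀ |c|^{3/2} < ∞`
  have hcT : ∫⁻ t in Ioo 0 T, ‖c t‖ₑ ^ (3 / 2 : ℝ) < ∞ := by
    have hm := hcL.eLpNorm_lt_top
    rw [eLpNorm_lt_top_iff_lintegral_rpow_enorm_lt_top (by norm_num)
      (ENNReal.div_ne_top (by norm_num) (by norm_num))] at hm
    have e : ((3 / 2 : ℝ≥0∞)).toReal = (3 / 2 : ℝ) := by
      rw [ENNReal.toReal_div]; norm_num
    rw [e] at hm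
    exact hm
  exact
    { suitable := Seregin2014Limit.isSuitableWeakSolutionOn_sub_gauge h.suitable hc hcT
      sqIntegrable := h.sqIntegrable
      pressure := fun K hK => by
        obtain ⟨r, hr⟩ := hK.isBounded.subset_ball (0 : (EuclideanSpace ℝ (Fin 3)))
        have hr' : K ⊆ ball (0 : (EuclideanSpace ℝ (Fin 3))) (max r 1) :=
          hr.trans (ball_subset_ball (le_max_left _ _))
        exact (lintegral_mono_set (prod_mono le_rfl hr')).trans_lt (hfin _ (by positivity))
      uniformLocalEnergy := h.uniformLocalEnergy
      uniformLocalGradient := h.uniformLocalGradient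
      initial := h.initial
      decay := h.decay }

namespace JiaSverak2014

open JiaSverak2013

/-! ### The window estimates from the raw hypotheses -/

/-- (Slab form of `JiaSverak2013.exists_lintegral_cube_window_le`: the weak gradient is given on a finite slab `(0,S) × ℝ³`, `t₂ ≤ S`.) **The cubic functional on a time window** `(t₁, t₂) ⊆ (0, ∞)`, `t₂ - t₁ ≤ 1`, of a field
with a weak spatial gradient on the slab `(0,∞) × ℝ³`: if `∫_{B_ρ(x₀)} |u(t)|² ≤ M` for a.e.
`t ∈ (t₁, t₂)` and `∫∫_{(t₁,t₂)×B_ρ(x₀)} |∇u|² ≤ M`, then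
`∫∫_{(t₁,t₂)×B_ρ(x₀)} |u|³ ≤ 2 K_c(ρ) M^{3/2} (t₂ - t₁)^{1/4}` (the tree's
`exists_lintegral_cube_box_le_explicit` on the translated window; Jia–Šverák 2013, proof of
Lemma 2: "Sobolev embedding theorem gives `sup_{x₀} ∫₀^{λR²}∫_{B_{2R}(x₀)} |u|³ ≤ C A(λ)^{3/2} R^{1/2} λ^{1/4}`").
[cite: JiaSverak2013, proof of Lemma 2 (arXiv:1201.1592 p. 3)] -/
theorem exists_lintegral_cube_window_le_slab (ρ : ℝ) :
    ∃ Kc : ℝ≥0, ∀ (u : ℝ → (EuclideanSpace ℝ (Fin 3)) → (EuclideanSpace ℝ (Fin 3))) (G : ℝ → (EuclideanSpace ℝ (Fin 3)) → (EuclideanSpace ℝ (Fin 3)) →L[ℝ] (EuclideanSpace ℝ (Fin 3))) (S t₁ t₂ : ℝ) (x₀ : (EuclideanSpace ℝ (Fin 3))) (M : ℝ≥0∞),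
      0 ≤ t₁ → t₁ ≤ t₂ → t₂ ≤ S → t₂ - t₁ ≤ 1 → M ≠ ⊤ →
      HasWeakSpatialGradientOn (slab (EuclideanSpace ℝ (Fin 3)) (Ioo 0 S) isOpen_Ioo) u G →
      (∀ᵐ t ∂(volume.restrict (Ioo t₁ t₂)), ∫⁻ x in ball x₀ ρ, ‖u t x‖ₑ ^ 2 ≤ M) →
      ∫⁻ z in Ioo t₁ t₂ ×ˢ ball x₀ ρ, ENNReal.ofReal (frobeniusNormSq (G z.1 z.2)) ≤ M →
      ∫⁻ z in Ioo t₁ t₂ ×ˢ ball x₀ ρ, ‖u z.1 z.2‖ₑ ^ (3 : ℕ) ≤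
        2 * Kc * M ^ (3 / 2 : ℝ) * ENNReal.ofReal (t₂ - t₁) ^ (1 / 4 : ℝ) := by
  obtain ⟨Kc, hKc⟩ := exists_lintegral_cube_box_le_explicit ρ
  refine ⟨Kc, fun u G S t₁ t₂ x₀ M h0 h12 h2S hδ1 hMtop hG hE hD => ?_⟩
  set δ : ℝ := t₂ - t₁ with hδ
  have hδ0 : 0 ≤ δ := by rw [hδ]; linarith
  -- the translated field on the slab `(0, δ) × ℝ³`
  set v : ℝ → (EuclideanSpace ℝ (Fin 3)) → (EuclideanSpace ℝ (Fin 3)) := fun s y => u (t₁ + s) y with hv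
  set G' : ℝ → (EuclideanSpace ℝ (Fin 3)) → (EuclideanSpace ℝ (Fin 3)) →L[ℝ] (EuclideanSpace ℝ (Fin 3)) := fun s y => G (t₁ + s) y with hG'
  have hsub : Ioo t₁ t₂ ⊆ Ioo (0 : ℝ) S := Ioo_subset_Ioo h0 h2S
  have hGw : HasWeakSpatialGradientOn (slab (EuclideanSpace ℝ (Fin 3)) (Ioo t₁ t₂) isOpen_Ioo) u G :=
    hG.mono (slab_mono hsub)
  have hG'' : HasWeakSpatialGradientOn (slab (EuclideanSpace ℝ (Fin 3)) (Ioo 0 δ) isOpen_Ioo) v G' := by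
    have h1 := hGw.timeShift t₁
    simp only [sub_self] at h1
    exact h1
  -- the hypotheses on the translated window
  have hE' : ∀ᵐ s ∂(volume.restrict (Ioo 0 δ)), ∫⁻ x in ball x₀ ρ, ‖v s x‖ₑ ^ 2 ≤ M :=
    ae_restrict_Ioo_comp_add hE
  have hD' : ∫⁻ z in Ioo 0 δ ×ˢ ball x₀ ρ, ENNReal.ofReal (frobeniusNormSq (G' z.1 z.2)) ≤ M := by
    have e := setLIntegral_prod_timeShift t₁ t₁ t₂ (ball x₀ ρ)
      (fun z : ℝ × (EuclideanSpace ℝ (Fin 3)) => ENNReal.ofReal (frobeniusNormSq (G z.1 z.2)))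
    rw [sub_self] at e
    rw [hG']
    exact e.le.trans hD
  have hcube := hKc δ v G' x₀ M M hMtop hG'' hE' hD'
  have e3 := setLIntegral_prod_timeShift t₁ t₁ t₂ (ball x₀ ρ)
    (fun z : ℝ × (EuclideanSpace ℝ (Fin 3)) => ‖u z.1 z.2‖ₑ ^ (3 : ℕ))
  rw [sub_self] at e3
  rw [← e3]
  refine hcube.trans ?_
  -- ## the algebra `M^{1/2} (M δ)^{1/4} (M δ + M)^{3/4} ≤ 2 M^{3/2} δ^{1/4}`
  have hvol : volume (Ioo (0 : ℝ) δ) = ENNReal.ofReal δ := by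
    rw [Real.volume_Ioo, sub_zero]
  rw [hvol]
  set d : ℝ≥0∞ := ENNReal.ofReal δ with hd
  have hd1 : d ≤ 1 := by
    rw [hd]; exact ENNReal.ofReal_le_one.2 hδ1
  have h1 : (M * d) ^ (1 / 4 : ℝ) = M ^ (1 / 4 : ℝ) * d ^ (1 / 4 : ℝ) :=
    ENNReal.mul_rpow_of_nonneg _ _ (by norm_num)
  have h2 : (M * d + M) ^ (3 / 4 : ℝ) ≤ 2 * M ^ (3 / 4 : ℝ) := by
    have hle : M * d + M ≤ 2 * M := by
      calc M * d + M ≤ M * 1 + M := by gcongr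
        _ = 2 * M := by ring
    calc (M * d + M) ^ (3 / 4 : ℝ) ≤ (2 * M) ^ (3 / 4 : ℝ) := ENNReal.rpow_le_rpow hle (by norm_num)
      _ = (2 : ℝ≥0∞) ^ (3 / 4 : ℝ) * M ^ (3 / 4 : ℝ) := ENNReal.mul_rpow_of_nonneg _ _ (by norm_num)
      _ ≤ 2 * M ^ (3 / 4 : ℝ) := by
          gcongr
          conv_rhs => rw [← ENNReal.rpow_one 2]
          exact ENNReal.rpow_le_rpow_of_exponent_le (by norm_num) (by norm_num)
  have h3 : M ^ (1 / 2 : ℝ) * M ^ (1 / 4 : ℝ) * M ^ (3 / 4 : ℝ) = M ^ (3 / 2 : ℝ) := by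
    rw [← ENNReal.rpow_add_of_nonneg _ _ (by norm_num) (by norm_num),
      ← ENNReal.rpow_add_of_nonneg _ _ (by norm_num) (by norm_num)]
    norm_num
  calc (Kc : ℝ≥0∞) * M ^ (1 / 2 : ℝ) * ((M * d) ^ (1 / 4 : ℝ) * (M * d + M) ^ (3 / 4 : ℝ))
      ≤ (Kc : ℝ≥0∞) * M ^ (1 / 2 : ℝ) * ((M ^ (1 / 4 : ℝ) * d ^ (1 / 4 : ℝ)) * (2 * M ^ (3 / 4 : ℝ))) := by
        rw [h1]; gcongr
    _ = 2 * Kc * (M ^ (1 / 2 : ℝ) * M ^ (1 / 4 : ℝ) * M ^ (3 / 4 : ℝ)) * d ^ (1 / 4 : ℝ) := by ring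
    _ = 2 * Kc * M ^ (3 / 2 : ℝ) * d ^ (1 / 4 : ℝ) := by rw [h3]


/-- (Slab form of `JiaSverak2013.lintegral_window_pressure_le`, from the raw hypotheses: `u`, `π` measurable on `(0,S) × ℝ³`, `∫∫_{(0,S)×B_6(y)} |u|³ < ∞`.) **The gauged pressure on a time window** (Jia–Šverák 2013, proof of Lemma 2: "by elliptic
estimates and `|k(x-y) - k(x₀-y)| ≤ CR|x₀-y|⁻⁴` … we easily obtain
`‖p - p(t)‖_{L^{3/2}(B_{2R}(x₀)×(0,λR²))} ≤ C(‖u‖²_{L³(B_{8R}(x₀)×(0,λR²))} + ‖R⁻³A(λ)‖_{L^{3/2}})`";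
Kang–Miura–Tsai 2021, §8, the bounds for `p_loc` (Calderón–Zygmund, slice by slice) and `p_far`
(two-centre kernel bound and the uniformly local tail), here on an arbitrary window
`(t₁, t₂) ⊆ (0, S)` at unit scale, radius `3`): if `π - c = π_loc + π_far` a.e. on
`(0,S) × B_3(y)` and the unit-ball energies of `u(t)` are `≤ E` for a.e. `t ∈ (t₁, t₂)`, then
`∫∫_{(t₁,t₂)×B_3(y)} |π - c|^{3/2} ≤ √2 Cₙ ∫∫_{(t₁,t₂)×B_6(y)} |u|³ + √2 |B_3| (3C_K · Tail(E))^{3/2} (t₂ - t₁)`,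
`Tail(E) = |B_1|⁻¹ E · 16 ∫_{|z|≥5} |z|⁻⁴`.
[cite: JiaSverak2013, proof of Lemma 2 (arXiv:1201.1592 p. 3)] [cite: KangMiuraTsai2020, §8 proof of Lemma 3.4 (bounds for p_loc, p_far), arXiv:1812.10509 p. 18] -/
theorem lintegral_window_pressure_le_slab
    {Cn : ℝ≥0∞}
    (hnear : ∀ (x₀ : (EuclideanSpace ℝ (Fin 3))) (r : ℝ) (v : ℝ → (EuclideanSpace ℝ (Fin 3)) → (EuclideanSpace ℝ (Fin 3))) (t : ℝ), AEStronglyMeasurable (v t) volume →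
        ∫⁻ x in ball x₀ (2 * r), ‖v t x‖ₑ ^ (3 : ℕ) ≠ ⊤ →
          ∫⁻ x, ‖localPressureNear x₀ r v t x‖ₑ ^ (3 / 2 : ℝ) ≤
            Cn * ∫⁻ x in ball x₀ (2 * r), ‖v t x‖ₑ ^ (3 : ℕ))
    {CK : ℝ} (hCK0 : 0 ≤ CK)
    (hCK : ∀ x₀ x y a : (EuclideanSpace ℝ (Fin 3)), 2 * ‖x - x₀‖ ≤ ‖y - x₀‖ → y ≠ x₀ →
      |pressureKernel (x - y) a - pressureKernel (x₀ - y) a| ≤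
        CK * ‖x - x₀‖ * ‖a‖ ^ 2 / ‖y - x₀‖ ^ 4)
    {u : ℝ → (EuclideanSpace ℝ (Fin 3)) → (EuclideanSpace ℝ (Fin 3))} {p : ℝ → (EuclideanSpace ℝ (Fin 3)) → ℝ} {S : ℝ}
    (hvm0 : AEStronglyMeasurable (uncurry u) (volume.restrict (Ioo 0 S ×ˢ (univ : Set (EuclideanSpace ℝ (Fin 3))))))
    (hπm0 : AEStronglyMeasurable (uncurry p) (volume.restrict (Ioo 0 S ×ˢ (univ : Set (EuclideanSpace ℝ (Fin 3))))))
    {t₁ t₂ : ℝ} (h0 : 0 ≤ t₁) (_h12 : t₁ ≤ t₂) (h2S : t₂ ≤ S) (y : (EuclideanSpace ℝ (Fin 3)))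
    (hcube : ∫⁻ z in Ioo 0 S ×ˢ ball y (2 * 3), ‖u z.1 z.2‖ₑ ^ (3 : ℕ) < ⊤)
    {c : ℝ → ℝ} (hcm : AEStronglyMeasurable c (volume.restrict (Ioo 0 S)))
    (hdec : ∀ᵐ z ∂(volume.restrict (Ioo 0 S ×ˢ ball y 3)),
      p z.1 z.2 - c z.1 = localPressureNear y 3 u z.1 z.2 + localPressureFar y 3 u z.1 z.2)
    {E : ℝ≥0∞} (hE : ∀ᵐ t ∂(volume.restrict (Ioo t₁ t₂)), ∀ z : (EuclideanSpace ℝ (Fin 3)),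
      ∫⁻ x in ball z 1, ‖u t x‖ₑ ^ 2 ≤ E) :
    ∫⁻ z in Ioo t₁ t₂ ×ˢ ball y 3, ‖p z.1 z.2 - c z.1‖ₑ ^ (3 / 2 : ℝ) ≤
      (2 : ℝ≥0∞) ^ (1 / 2 : ℝ) * Cn * (∫⁻ z in Ioo t₁ t₂ ×ˢ ball y (2 * 3), ‖u z.1 z.2‖ₑ ^ (3 : ℕ)) +
      (2 : ℝ≥0∞) ^ (1 / 2 : ℝ) *
        ((ENNReal.ofReal (CK * 3) * ((volume (ball (0 : (EuclideanSpace ℝ (Fin 3))) 1))⁻¹ *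
            (E * (16 * ∫⁻ z in (ball (0 : (EuclideanSpace ℝ (Fin 3))) (2 * 3 - 1))ᶜ, RieszKernel.powKer 4 z)))) ^ (3 / 2 : ℝ) *
          volume (ball (0 : (EuclideanSpace ℝ (Fin 3))) 3)) * ENNReal.ofReal (t₂ - t₁) := by
  -- ## names
  set B : Set (EuclideanSpace ℝ (Fin 3)) := ball y 3 with hB
  set N := localPressureNear y 3 u with hN
  set Fa := localPressureFar y 3 u with hFa
  set μt : Measure ℝ := volume.restrict (Ioo t₁ t₂) with hμt
  set μB : Measure (EuclideanSpace ℝ (Fin 3)) := volume.restrict B with hμB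
  set s2 : ℝ≥0∞ := (2 : ℝ≥0∞) ^ (1 / 2 : ℝ) with hs2
  set V1 : ℝ≥0∞ := volume (ball (0 : (EuclideanSpace ℝ (Fin 3))) 1) with hV1
  set VR : ℝ≥0∞ := volume (ball (0 : (EuclideanSpace ℝ (Fin 3))) 3) with hVR
  set cK : ℝ≥0∞ := ENNReal.ofReal (CK * 3) with hcK
  set Tail : ℝ≥0∞ := V1⁻¹ * (E * (16 * ∫⁻ z in (ball (0 : (EuclideanSpace ℝ (Fin 3))) (2 * 3 - 1))ᶜ, RieszKernel.powKer 4 z))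
    with hTail
  set g₃ : ℝ → ℝ≥0∞ := fun t => ∫⁻ x in ball y (2 * 3), ‖u t x‖ₑ ^ (3 : ℕ) with hg₃
  set G₃ : ℝ≥0∞ := ∫⁻ z in Ioo t₁ t₂ ×ˢ ball y (2 * 3), ‖u z.1 z.2‖ₑ ^ (3 : ℕ) with hG₃def
  have hs2top : s2 ≠ ⊤ := ENNReal.rpow_ne_top_of_nonneg (by norm_num) ENNReal.ofNat_ne_top
  have h3pos : (0 : ℝ) < 3 := by norm_num
  have h2R : (2 : ℝ) ≤ 2 * 3 := by norm_num
  have hsubI : Ioo t₁ t₂ ⊆ Ioo (0 : ℝ) S := Ioo_subset_Ioo h0 h2S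
  -- ## measurability on the window slab and its boxes
  have hvm : AEStronglyMeasurable (uncurry u) (volume.restrict (Ioo t₁ t₂ ×ˢ (univ : Set (EuclideanSpace ℝ (Fin 3))))) :=
    hvm0.mono_measure (Measure.restrict_mono (Set.prod_mono hsubI Subset.rfl) le_rfl)
  have hπm : AEStronglyMeasurable (uncurry p) (volume.restrict (Ioo t₁ t₂ ×ˢ (univ : Set (EuclideanSpace ℝ (Fin 3))))) :=
    hπm0.mono_measure (Measure.restrict_mono (Set.prod_mono hsubI Subset.rfl) le_rfl)
  have hbox : ∀ S' : Set (EuclideanSpace ℝ (Fin 3)), μt.prod (volume.restrict S') = volume.restrict (Ioo t₁ t₂ ×ˢ S') :=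
    fun S' => by rw [hμt, Measure.prod_restrict, ← Measure.volume_eq_prod]
  have hboxu : μt.prod (volume : Measure (EuclideanSpace ℝ (Fin 3))) = volume.restrict (Ioo t₁ t₂ ×ˢ (univ : Set (EuclideanSpace ℝ (Fin 3)))) := by
    conv_lhs => rw [← Measure.restrict_univ (μ := (volume : Measure (EuclideanSpace ℝ (Fin 3))))]
    exact hbox univ
  have hsub : ∀ S' : Set (EuclideanSpace ℝ (Fin 3)), Ioo t₁ t₂ ×ˢ S' ⊆ Ioo t₁ t₂ ×ˢ (univ : Set (EuclideanSpace ℝ (Fin 3))) := fun S' =>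
    Set.prod_mono Subset.rfl (subset_univ _)
  have hvmS : ∀ S' : Set (EuclideanSpace ℝ (Fin 3)), AEStronglyMeasurable (uncurry u) (μt.prod (volume.restrict S')) :=
    fun S' => by
    rw [hbox]
    exact hvm.mono_measure (Measure.restrict_mono (hsub S') le_rfl)
  have hF : ∀ (S' : Set (EuclideanSpace ℝ (Fin 3))) (n : ℕ),
      AEMeasurable (fun z : ℝ × (EuclideanSpace ℝ (Fin 3)) => ‖u z.1 z.2‖ₑ ^ n) (μt.prod (volume.restrict S')) :=
    fun S' n => (hvmS S').enorm.pow_const n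
  -- slices of `u` are measurable for a.e. `t` in the window
  have hslice_meas : ∀ᵐ t ∂μt, AEStronglyMeasurable (u t) volume := by
    have h1 : AEStronglyMeasurable (uncurry u) (μt.prod (volume : Measure (EuclideanSpace ℝ (Fin 3)))) := by
      rw [hboxu]; exact hvm
    exact h1.prodMk_left
  -- ## the cubic functional on the box of radius `6` is finite, hence so are a.e. slices
  have hG₃top : G₃ ≠ ⊤ :=
    ne_top_of_le_ne_top hcube.ne (lintegral_mono_set (Set.prod_mono hsubI Subset.rfl))
  have hg₃m : AEMeasurable g₃ μt := (hF (ball y (2 * 3)) 3).lintegral_prod_right'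
  have hT3 : G₃ = ∫⁻ t, g₃ t ∂μt := by
    rw [hG₃def, ← hbox, lintegral_prod _ (hF _ 3)]
  have hfin : ∀ᵐ t ∂μt, g₃ t < ⊤ := by
    refine ae_lt_top' hg₃m ?_
    rw [← hT3]
    exact hG₃top
  -- ## the expansion on the window, slice by slice
  have hdecw : ∀ᵐ z ∂(volume.restrict (Ioo t₁ t₂ ×ˢ B)), p z.1 z.2 - c z.1 = N z.1 z.2 + Fa z.1 z.2 :=
    ae_restrict_of_ae_restrict_of_subset (Set.prod_mono (Ioo_subset_Ioo h0 h2S) Subset.rfl) hdec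
  have hdec' : ∀ᵐ t ∂μt, ∀ᵐ x ∂μB, p t x - c t = N t x + Fa t x := by
    have h1 : ∀ᵐ z ∂μt.prod μB, p z.1 z.2 - c z.1 = N z.1 z.2 + Fa z.1 z.2 := by
      rw [hμB, hbox]
      exact hdecw
    exact Measure.ae_ae_of_ae_prod h1
  have hcmw : AEStronglyMeasurable c μt :=
    hcm.mono_measure (Measure.restrict_mono (Ioo_subset_Ioo h0 h2S) le_rfl)
  have hGm' : AEStronglyMeasurable (fun z : ℝ × (EuclideanSpace ℝ (Fin 3)) => p z.1 z.2 - c z.1) (μt.prod μB) := by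
    refine AEStronglyMeasurable.sub ?_ ?_
    · rw [hμB, hbox]
      exact hπm.mono_measure (Measure.restrict_mono (hsub B) le_rfl)
    · exact hcmw.comp_fst
  have hTI : ∫⁻ z in Ioo t₁ t₂ ×ˢ B, ‖p z.1 z.2 - c z.1‖ₑ ^ (3 / 2 : ℝ) =
      ∫⁻ t, ∫⁻ x, ‖p t x - c t‖ₑ ^ (3 / 2 : ℝ) ∂μB ∂μt := by
    rw [← hbox B, ← hμB, lintegral_prod _ (hGm'.enorm.pow_const _)]
  -- ## the slice estimate
  have hinner : ∀ᵐ t ∂μt, ∫⁻ x, ‖p t x - c t‖ₑ ^ (3 / 2 : ℝ) ∂μB ≤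
      s2 * Cn * g₃ t + s2 * ((cK * Tail) ^ (3 / 2 : ℝ) * VR) := by
    filter_upwards [hslice_meas, hfin, hdec', hE] with t hmt hft hdt hEt
    -- the far field at time `t`
    have hfar : ∫⁻ y' in (ball y (2 * 3))ᶜ,
        ‖u t y'‖ₑ ^ (2 : ℕ) * RieszKernel.powKer 4 (y' - y) ≤ Tail :=
      lintegral_compl_ball_mul_powKer_le (hmt.enorm.pow_const _) hEt y h2R
    have hFaB : ∀ x ∈ B, ‖Fa t x‖ₑ ≤ cK * Tail := fun x hx =>
      (enorm_localPressureFar_le hCK0 hCK y h3pos u t hx).trans (mul_le_mul' le_rfl hfar)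
    -- the near field at time `t`: Calderón–Zygmund
    have hNt : ∫⁻ x, ‖N t x‖ₑ ^ (3 / 2 : ℝ) ∂μB ≤ Cn * g₃ t :=
      (lintegral_mono' Measure.restrict_le_self le_rfl).trans (hnear y 3 u t hmt hft.ne)
    calc ∫⁻ x, ‖p t x - c t‖ₑ ^ (3 / 2 : ℝ) ∂μB
        = ∫⁻ x, ‖N t x + Fa t x‖ₑ ^ (3 / 2 : ℝ) ∂μB := by
          refine lintegral_congr_ae ?_
          filter_upwards [hdt] with x hx
          rw [hx]
      _ ≤ ∫⁻ x, (‖N t x‖ₑ + cK * Tail) ^ (3 / 2 : ℝ) ∂μB := by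
          rw [hμB]
          refine setLIntegral_mono' measurableSet_ball fun x hx => ?_
          exact ENNReal.rpow_le_rpow ((enorm_add_le _ _).trans
            (add_le_add le_rfl (hFaB x hx))) (by norm_num)
      _ ≤ ∫⁻ x, s2 * (‖N t x‖ₑ ^ (3 / 2 : ℝ) + (cK * Tail) ^ (3 / 2 : ℝ)) ∂μB :=
          lintegral_mono fun x => add_rpow_threeHalves_le _ _
      _ = s2 * (∫⁻ x, ‖N t x‖ₑ ^ (3 / 2 : ℝ) ∂μB + (cK * Tail) ^ (3 / 2 : ℝ) * volume B) := by
          rw [lintegral_const_mul' _ _ hs2top, lintegral_add_right' _ aemeasurable_const,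
            lintegral_const, hμB, Measure.restrict_apply_univ]
      _ ≤ s2 * (Cn * g₃ t + (cK * Tail) ^ (3 / 2 : ℝ) * VR) := by
          rw [hB, Measure.addHaar_ball_center volume y 3]
          gcongr
      _ = s2 * Cn * g₃ t + s2 * ((cK * Tail) ^ (3 / 2 : ℝ) * VR) := by ring
  -- ## integrate in time
  have hμtuniv : μt univ = ENNReal.ofReal (t₂ - t₁) := by
    rw [hμt, Measure.restrict_apply_univ, Real.volume_Ioo]
  have hm1 : AEMeasurable (fun t => s2 * Cn * g₃ t) μt := hg₃m.const_mul _
  calc ∫⁻ z in Ioo t₁ t₂ ×ˢ B, ‖p z.1 z.2 - c z.1‖ₑ ^ (3 / 2 : ℝ)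
      = ∫⁻ t, ∫⁻ x, ‖p t x - c t‖ₑ ^ (3 / 2 : ℝ) ∂μB ∂μt := hTI
    _ ≤ ∫⁻ t, (s2 * Cn * g₃ t + s2 * ((cK * Tail) ^ (3 / 2 : ℝ) * VR)) ∂μt :=
        lintegral_mono_ae hinner
    _ = s2 * Cn * ∫⁻ t, g₃ t ∂μt + s2 * ((cK * Tail) ^ (3 / 2 : ℝ) * VR) * μt univ := by
        rw [lintegral_add_left' hm1, lintegral_const_mul'' _ hg₃m, lintegral_const]
    _ = s2 * Cn * G₃ + s2 * ((cK * Tail) ^ (3 / 2 : ℝ) * VR) * ENNReal.ofReal (t₂ - t₁) := by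
        rw [← hT3, hμtuniv]


/-- (Slab form of `JiaSverak2013.exists_window_flux_le`, from the raw hypotheses on `(0,S) × ℝ³`.) **The flux of the local energy inequality on a time window** (Jia–Šverák 2013, proof of
Lemma 2, the estimate "`∫|u|²/2 φ(x-x₀) + ∫₀ᵗ∫|∇u|²φ(x-x₀) ≤ α + CλA(λ) + CA(λ)^{3/2}λ^{1/4}R^{-1/2}`"
at unit scale, for the window `(t₁, t₂)`, `t₂ - t₁ ≤ 1`, in place of `(0, λR²)`): there are
absolute constants `K₁, K₂` such that for every local Leray solution `(u, p)` with weak gradient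
`G`, every centre `y` with gauge `c` (`p - c = p_loc + p_far` a.e. on `(0,S) × B_3(y)`), and all
bounds `E, D ≤ M < ∞` of the unit-ball energies of `u(t)` (a.e. `t` in the window) and of the
unit-ball dissipations `∫∫_{(t₁,t₂)×B_1(z)} |G|²`,
`∫∫_{(t₁,t₂)×B_3(y)} | |u|²Δφ_y + (|u|² + 2(p - c)) u·∇φ_y | ≤ K₁ (t₂ - t₁) M + K₂ M^{3/2} (t₂ - t₁)^{1/4}`
(the three terms: `|u|²|Δφ|` by the uniformly local energy; `|u|³|∇φ|` by the cubic functional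
`≲ M^{3/2}(t₂-t₁)^{1/4}`; `|p - c||u||∇φ|` by Hölder, the gauged pressure bound and the cubic
functional). [cite: JiaSverak2013, proof of Lemma 2 (arXiv:1201.1592 p. 3)] -/
theorem exists_window_flux_le_slab :
    ∃ K₁ K₂ : ℝ≥0, ∀ {u : ℝ → (EuclideanSpace ℝ (Fin 3)) → (EuclideanSpace ℝ (Fin 3))} {p : ℝ → (EuclideanSpace ℝ (Fin 3)) → ℝ} {S : ℝ}
      (_hvm0 : AEStronglyMeasurable (uncurry u) (volume.restrict (Ioo 0 S ×ˢ (univ : Set (EuclideanSpace ℝ (Fin 3))))))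
      (_hπm0 : AEStronglyMeasurable (uncurry p) (volume.restrict (Ioo 0 S ×ˢ (univ : Set (EuclideanSpace ℝ (Fin 3))))))
      (_hcube : ∀ (y : (EuclideanSpace ℝ (Fin 3))) (ρ : ℝ), ∫⁻ z in Ioo 0 S ×ˢ ball y ρ, ‖u z.1 z.2‖ₑ ^ (3 : ℕ) < ⊤)
      {G : ℝ → (EuclideanSpace ℝ (Fin 3)) → (EuclideanSpace ℝ (Fin 3)) →L[ℝ] (EuclideanSpace ℝ (Fin 3))}
      (_hG : HasWeakSpatialGradientOn (slab (EuclideanSpace ℝ (Fin 3)) (Ioo 0 S) isOpen_Ioo) u G)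
      {t₁ t₂ : ℝ} (_h0 : 0 ≤ t₁) (_h12 : t₁ ≤ t₂) (_h2S : t₂ ≤ S) (_hδ1 : t₂ - t₁ ≤ 1) (y : (EuclideanSpace ℝ (Fin 3)))
      {c : ℝ → ℝ} (_hcm : AEStronglyMeasurable c (volume.restrict (Ioo 0 S)))
      (_hdec : ∀ᵐ z ∂(volume.restrict (Ioo 0 S ×ˢ ball y 3)),
        p z.1 z.2 - c z.1 = localPressureNear y 3 u z.1 z.2 + localPressureFar y 3 u z.1 z.2)
      {E D M : ℝ≥0∞} (_hMtop : M ≠ ⊤) (_hEM : E ≤ M) (_hDM : D ≤ M)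
      (_hE : ∀ᵐ t ∂(volume.restrict (Ioo t₁ t₂)), ∀ z : (EuclideanSpace ℝ (Fin 3)), ∫⁻ x in ball z 1, ‖u t x‖ₑ ^ 2 ≤ E)
      (_hD : ∀ z : (EuclideanSpace ℝ (Fin 3)),
        ∫⁻ w in Ioo t₁ t₂ ×ˢ ball z 1, ENNReal.ofReal (frobeniusNormSq (G w.1 w.2)) ≤ D),
      ∫⁻ z in Ioo t₁ t₂ ×ˢ ball y 3,
          ‖‖u z.1 z.2‖ ^ 2 * Δ (fun w => radialCutoff 2 3 (y - w)) z.2 +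
            (‖u z.1 z.2‖ ^ 2 + 2 * (p z.1 z.2 - c z.1)) * ⟪u z.1 z.2, gradient (fun w => radialCutoff 2 3 (y - w)) z.2⟫‖ₑ ≤
        K₁ * ENNReal.ofReal (t₂ - t₁) * M +
          K₂ * M ^ (3 / 2 : ℝ) * ENNReal.ofReal (t₂ - t₁) ^ (1 / 4 : ℝ) := by
  obtain ⟨CΔ, Cg, hCΔ0, hCg0, hCΔ, hCg⟩ := exists_testFn_bounds
  obtain ⟨Cn, -, hCntop, hnear⟩ :=
    exists_lintegral_localPressureNear_le stein1970_normalisedPressure_ae_Lp_bound_holds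
  obtain ⟨CK, hCK0, hCK⟩ := exists_abs_pressureKernel_sub_le
  obtain ⟨Kc₃, hKc₃⟩ := exists_lintegral_cube_window_le_slab 3
  obtain ⟨Kc₆, hKc₆⟩ := exists_lintegral_cube_window_le_slab (2 * 3)
  -- ## constants
  set V1 : ℝ≥0∞ := volume (ball (0 : (EuclideanSpace ℝ (Fin 3))) 1) with hV1
  set N₃ : ℝ≥0∞ := V1⁻¹ * volume (ball (0 : (EuclideanSpace ℝ (Fin 3))) (3 + 1)) with hN₃
  set N₆ : ℝ≥0∞ := V1⁻¹ * volume (ball (0 : (EuclideanSpace ℝ (Fin 3))) (2 * 3 + 1)) with hN₆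
  set Q₀ : ℝ≥0∞ := 2 * Kc₃ * N₃ ^ (3 / 2 : ℝ) with hQ₀
  set s2 : ℝ≥0∞ := (2 : ℝ≥0∞) ^ (1 / 2 : ℝ) with hs2
  set cK : ℝ≥0∞ := ENNReal.ofReal (CK * 3) with hcK
  set τ₀ : ℝ≥0∞ := V1⁻¹ * (16 * ∫⁻ z in (ball (0 : (EuclideanSpace ℝ (Fin 3))) (2 * 3 - 1))ᶜ, RieszKernel.powKer 4 z)
    with hτ₀
  set V3 : ℝ≥0∞ := volume (ball (0 : (EuclideanSpace ℝ (Fin 3))) 3) with hV3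
  set P₀ : ℝ≥0∞ := s2 * Cn * (2 * Kc₆ * N₆ ^ (3 / 2 : ℝ)) + s2 * ((cK * τ₀) ^ (3 / 2 : ℝ) * V3)
    with hP₀
  set K₁ : ℝ≥0∞ := ENNReal.ofReal CΔ * N₃ with hK₁
  set K₂ : ℝ≥0∞ := ENNReal.ofReal Cg * Q₀ + 2 * ENNReal.ofReal Cg * (P₀ ^ (2 / 3 : ℝ) * Q₀ ^ (1 / 3 : ℝ))
    with hK₂
  -- ## finiteness of the constants
  have hV10 : V1 ≠ 0 := volume_unitBall_ne_zero
  have hV1inv : V1⁻¹ ≠ ⊤ := ENNReal.inv_ne_top.2 hV10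
  have hN₃top : N₃ ≠ ⊤ := ENNReal.mul_ne_top hV1inv measure_ball_lt_top.ne
  have hN₆top : N₆ ≠ ⊤ := ENNReal.mul_ne_top hV1inv measure_ball_lt_top.ne
  have hs2top : s2 ≠ ⊤ := ENNReal.rpow_ne_top_of_nonneg (by norm_num) ENNReal.ofNat_ne_top
  have hQ₀top : Q₀ ≠ ⊤ := ENNReal.mul_ne_top (ENNReal.mul_ne_top ENNReal.ofNat_ne_top ENNReal.coe_ne_top)
    (ENNReal.rpow_ne_top_of_nonneg (by norm_num) hN₃top)
  have hτ₀top : τ₀ ≠ ⊤ := by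
    refine ENNReal.mul_ne_top hV1inv (ENNReal.mul_ne_top (by norm_num) ?_)
    exact (RieszKernel.lintegral_compl_ball_powKer_lt_top (by norm_num) (by norm_num)).ne
  have hP₀top : P₀ ≠ ⊤ := by
    refine ENNReal.add_ne_top.2 ⟨?_, ?_⟩
    · exact ENNReal.mul_ne_top (ENNReal.mul_ne_top hs2top hCntop)
        (ENNReal.mul_ne_top (ENNReal.mul_ne_top ENNReal.ofNat_ne_top ENNReal.coe_ne_top)
          (ENNReal.rpow_ne_top_of_nonneg (by norm_num) hN₆top))
    · refine ENNReal.mul_ne_top hs2top (ENNReal.mul_ne_top ?_ measure_ball_lt_top.ne)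
      exact ENNReal.rpow_ne_top_of_nonneg (by norm_num)
        (ENNReal.mul_ne_top ENNReal.ofReal_ne_top hτ₀top)
  have hK₁top : K₁ ≠ ⊤ := ENNReal.mul_ne_top ENNReal.ofReal_ne_top hN₃top
  have hK₂top : K₂ ≠ ⊤ := by
    refine ENNReal.add_ne_top.2 ⟨ENNReal.mul_ne_top ENNReal.ofReal_ne_top hQ₀top, ?_⟩
    refine ENNReal.mul_ne_top (ENNReal.mul_ne_top ENNReal.ofNat_ne_top ENNReal.ofReal_ne_top) ?_
    exact ENNReal.mul_ne_top (ENNReal.rpow_ne_top_of_nonneg (by norm_num) hP₀top)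
      (ENNReal.rpow_ne_top_of_nonneg (by norm_num) hQ₀top)
  refine ⟨K₁.toNNReal, K₂.toNNReal, ?_⟩
  intro u p S hvm0 hπm0 hcube G hG t₁ t₂ h0 h12 h2S hδ1 y c hcm hdec E D M hMtop hEM hDM hE hD
  rw [ENNReal.coe_toNNReal hK₁top, ENNReal.coe_toNNReal hK₂top]
  -- ## names
  set δ' : ℝ≥0∞ := ENNReal.ofReal (t₂ - t₁) with hδ'
  set Y : ℝ≥0∞ := M ^ (3 / 2 : ℝ) * δ' ^ (1 / 4 : ℝ) with hY
  set B : Set (EuclideanSpace ℝ (Fin 3)) := ball y 3 with hB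
  set μt : Measure ℝ := volume.restrict (Ioo t₁ t₂) with hμt
  set μB : Measure (EuclideanSpace ℝ (Fin 3)) := volume.restrict B with hμB
  set μ : Measure (ℝ × (EuclideanSpace ℝ (Fin 3))) := volume.restrict (Ioo t₁ t₂ ×ˢ B) with hμ
  have hδ'1 : δ' ≤ 1 := ENNReal.ofReal_le_one.2 hδ1
  have hsubI : Ioo t₁ t₂ ⊆ Ioo (0 : ℝ) S := Ioo_subset_Ioo h0 h2S
  -- ## measurability
  have hvm : AEStronglyMeasurable (uncurry u) (volume.restrict (Ioo t₁ t₂ ×ˢ (univ : Set (EuclideanSpace ℝ (Fin 3))))) :=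
    hvm0.mono_measure (Measure.restrict_mono (Set.prod_mono hsubI Subset.rfl) le_rfl)
  have hπm : AEStronglyMeasurable (uncurry p) (volume.restrict (Ioo t₁ t₂ ×ˢ (univ : Set (EuclideanSpace ℝ (Fin 3))))) :=
    hπm0.mono_measure (Measure.restrict_mono (Set.prod_mono hsubI Subset.rfl) le_rfl)
  have hGm : AEStronglyMeasurable (uncurry G) (volume.restrict (Ioo t₁ t₂ ×ˢ (univ : Set (EuclideanSpace ℝ (Fin 3))))) := by
    have hGw : HasWeakSpatialGradientOn (slab (EuclideanSpace ℝ (Fin 3)) (Ioo t₁ t₂) isOpen_Ioo) u G :=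
      hG.mono (slab_mono hsubI)
    exact hGw.locallyIntegrableOn_grad.aestronglyMeasurable
  have hbox : ∀ S' : Set (EuclideanSpace ℝ (Fin 3)), μt.prod (volume.restrict S') = volume.restrict (Ioo t₁ t₂ ×ˢ S') :=
    fun S' => by rw [hμt, Measure.prod_restrict, ← Measure.volume_eq_prod]
  have hboxu : μt.prod (volume : Measure (EuclideanSpace ℝ (Fin 3))) = volume.restrict (Ioo t₁ t₂ ×ˢ (univ : Set (EuclideanSpace ℝ (Fin 3)))) := by
    conv_lhs => rw [← Measure.restrict_univ (μ := (volume : Measure (EuclideanSpace ℝ (Fin 3))))]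
    exact hbox univ
  have hsub : ∀ S' : Set (EuclideanSpace ℝ (Fin 3)), Ioo t₁ t₂ ×ˢ S' ⊆ Ioo t₁ t₂ ×ˢ (univ : Set (EuclideanSpace ℝ (Fin 3))) := fun S' =>
    Set.prod_mono Subset.rfl (subset_univ _)
  have hvmS : ∀ S' : Set (EuclideanSpace ℝ (Fin 3)), AEStronglyMeasurable (uncurry u) (volume.restrict (Ioo t₁ t₂ ×ˢ S')) :=
    fun S' => hvm.mono_measure (Measure.restrict_mono (hsub S') le_rfl)
  have hslice_meas : ∀ᵐ t ∂μt, AEStronglyMeasurable (u t) volume := by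
    have h1 : AEStronglyMeasurable (uncurry u) (μt.prod (volume : Measure (EuclideanSpace ℝ (Fin 3)))) := by
      rw [hboxu]; exact hvm
    exact h1.prodMk_left
  have hUm : AEMeasurable (fun z : ℝ × (EuclideanSpace ℝ (Fin 3)) => ‖u z.1 z.2‖ₑ) μ := (hvmS B).enorm
  have hQm : AEMeasurable (fun z : ℝ × (EuclideanSpace ℝ (Fin 3)) => ‖p z.1 z.2 - c z.1‖ₑ) μ := by
    refine (AEStronglyMeasurable.sub ?_ ?_).enorm
    · exact hπm.mono_measure (Measure.restrict_mono (hsub B) le_rfl)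
    · have hcmw : AEStronglyMeasurable c μt :=
        hcm.mono_measure (Measure.restrict_mono (Ioo_subset_Ioo h0 h2S) le_rfl)
      have h2 : AEStronglyMeasurable (fun z : ℝ × (EuclideanSpace ℝ (Fin 3)) => c z.1) (μt.prod μB) := hcmw.comp_fst
      rw [hμB, hbox] at h2
      exact h2
  -- ## radius-3 and radius-6 bounds from the unit-ball bounds
  have hE₃ : ∀ᵐ t ∂μt, ∫⁻ x in ball y 3, ‖u t x‖ₑ ^ 2 ≤ N₃ * M := by
    filter_upwards [hslice_meas, hE] with t hmt hEt
    calc ∫⁻ x in ball y 3, ‖u t x‖ₑ ^ 2 ≤ V1⁻¹ * (E * volume (ball (0 : (EuclideanSpace ℝ (Fin 3))) (3 + 1))) :=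
          setLIntegral_ball_le_of_forall_unitBall (hmt.enorm.pow_const 2) hEt y 3
      _ ≤ V1⁻¹ * (M * volume (ball (0 : (EuclideanSpace ℝ (Fin 3))) (3 + 1))) := by gcongr
      _ = N₃ * M := by rw [hN₃]; ring
  have hE₆ : ∀ᵐ t ∂μt, ∫⁻ x in ball y (2 * 3), ‖u t x‖ₑ ^ 2 ≤ N₆ * M := by
    filter_upwards [hslice_meas, hE] with t hmt hEt
    calc ∫⁻ x in ball y (2 * 3), ‖u t x‖ₑ ^ 2 ≤ V1⁻¹ * (E * volume (ball (0 : (EuclideanSpace ℝ (Fin 3))) (2 * 3 + 1))) :=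
          setLIntegral_ball_le_of_forall_unitBall (hmt.enorm.pow_const 2) hEt y (2 * 3)
      _ ≤ V1⁻¹ * (M * volume (ball (0 : (EuclideanSpace ℝ (Fin 3))) (2 * 3 + 1))) := by gcongr
      _ = N₆ * M := by rw [hN₆]; ring
  have hFG : AEMeasurable (fun w : ℝ × (EuclideanSpace ℝ (Fin 3)) => ENNReal.ofReal (frobeniusNormSq (G w.1 w.2)))
      (volume.restrict (Ioo t₁ t₂ ×ˢ (univ : Set (EuclideanSpace ℝ (Fin 3))))) :=
    (continuous_frobeniusNormSq'.comp_aestronglyMeasurable hGm).aemeasurable.ennreal_ofReal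
  have hD₃ : ∫⁻ w in Ioo t₁ t₂ ×ˢ ball y 3, ENNReal.ofReal (frobeniusNormSq (G w.1 w.2)) ≤ N₃ * M := by
    calc ∫⁻ w in Ioo t₁ t₂ ×ˢ ball y 3, ENNReal.ofReal (frobeniusNormSq (G w.1 w.2))
        ≤ V1⁻¹ * (D * volume (ball (0 : (EuclideanSpace ℝ (Fin 3))) (3 + 1))) :=
          lintegral_box_ball_le_of_forall_unitBall hFG hD y 3
      _ ≤ V1⁻¹ * (M * volume (ball (0 : (EuclideanSpace ℝ (Fin 3))) (3 + 1))) := by gcongr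
      _ = N₃ * M := by rw [hN₃]; ring
  have hD₆ : ∫⁻ w in Ioo t₁ t₂ ×ˢ ball y (2 * 3), ENNReal.ofReal (frobeniusNormSq (G w.1 w.2)) ≤
      N₆ * M := by
    calc ∫⁻ w in Ioo t₁ t₂ ×ˢ ball y (2 * 3), ENNReal.ofReal (frobeniusNormSq (G w.1 w.2))
        ≤ V1⁻¹ * (D * volume (ball (0 : (EuclideanSpace ℝ (Fin 3))) (2 * 3 + 1))) :=
          lintegral_box_ball_le_of_forall_unitBall hFG hD y (2 * 3)
      _ ≤ V1⁻¹ * (M * volume (ball (0 : (EuclideanSpace ℝ (Fin 3))) (2 * 3 + 1))) := by gcongr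
      _ = N₆ * M := by rw [hN₆]; ring
  -- ## the cubic functionals
  have hN₃Mtop : N₃ * M ≠ ⊤ := ENNReal.mul_ne_top hN₃top hMtop
  have hN₆Mtop : N₆ * M ≠ ⊤ := ENNReal.mul_ne_top hN₆top hMtop
  set CUBE₃ : ℝ≥0∞ := ∫⁻ z in Ioo t₁ t₂ ×ˢ ball y 3, ‖u z.1 z.2‖ₑ ^ (3 : ℕ) with hCUBE₃
  set CUBE₆ : ℝ≥0∞ := ∫⁻ z in Ioo t₁ t₂ ×ˢ ball y (2 * 3), ‖u z.1 z.2‖ₑ ^ (3 : ℕ) with hCUBE₆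
  have hC₃ : CUBE₃ ≤ Q₀ * Y := by
    have h := hKc₃ u G S t₁ t₂ y (N₃ * M) h0 h12 h2S hδ1 hN₃Mtop hG hE₃ hD₃
    refine h.trans (le_of_eq ?_)
    rw [hQ₀, hY, ENNReal.mul_rpow_of_nonneg _ _ (by norm_num : (0:ℝ) ≤ 3 / 2)]
    ring
  have hC₆ : CUBE₆ ≤ (2 * Kc₆ * N₆ ^ (3 / 2 : ℝ)) * Y := by
    have h := hKc₆ u G S t₁ t₂ y (N₆ * M) h0 h12 h2S hδ1 hN₆Mtop hG hE₆ hD₆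
    refine h.trans (le_of_eq ?_)
    rw [hY, ENNReal.mul_rpow_of_nonneg _ _ (by norm_num : (0:ℝ) ≤ 3 / 2)]
    ring
  -- ## the gauged pressure
  set PRESS : ℝ≥0∞ := ∫⁻ z in Ioo t₁ t₂ ×ˢ ball y 3, ‖p z.1 z.2 - c z.1‖ₑ ^ (3 / 2 : ℝ) with hPRESS
  have hP : PRESS ≤ P₀ * Y := by
    have h := lintegral_window_pressure_le_slab hnear hCK0 hCK hvm0 hπm0 h0 h12 h2S y (hcube y (2 * 3)) hcm hdec hE
    refine h.trans ?_
    have hTail : (cK * (V1⁻¹ * (E * (16 * ∫⁻ z in (ball (0 : (EuclideanSpace ℝ (Fin 3))) (2 * 3 - 1))ᶜ,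
        RieszKernel.powKer 4 z)))) ^ (3 / 2 : ℝ) ≤ (cK * τ₀) ^ (3 / 2 : ℝ) * M ^ (3 / 2 : ℝ) := by
      rw [← ENNReal.mul_rpow_of_nonneg _ _ (by norm_num : (0:ℝ) ≤ 3 / 2)]
      refine ENNReal.rpow_le_rpow ?_ (by norm_num)
      calc cK * (V1⁻¹ * (E * (16 * ∫⁻ z in (ball (0 : (EuclideanSpace ℝ (Fin 3))) (2 * 3 - 1))ᶜ, RieszKernel.powKer 4 z)))
          = cK * τ₀ * E := by rw [hτ₀]; ring
        _ ≤ cK * τ₀ * M := by gcongr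
    have hδY : M ^ (3 / 2 : ℝ) * δ' ≤ Y := by
      rw [hY]
      gcongr
      conv_lhs => rw [← ENNReal.rpow_one δ']
      exact ENNReal.rpow_le_rpow_of_exponent_ge hδ'1 (by norm_num)
    calc s2 * Cn * CUBE₆ + s2 * ((cK * (V1⁻¹ * (E * (16 * ∫⁻ z in (ball (0 : (EuclideanSpace ℝ (Fin 3))) (2 * 3 - 1))ᶜ,
            RieszKernel.powKer 4 z)))) ^ (3 / 2 : ℝ) * V3) * δ'
        ≤ s2 * Cn * ((2 * Kc₆ * N₆ ^ (3 / 2 : ℝ)) * Y) +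
            s2 * (((cK * τ₀) ^ (3 / 2 : ℝ) * M ^ (3 / 2 : ℝ)) * V3) * δ' := by gcongr
      _ = s2 * Cn * (2 * Kc₆ * N₆ ^ (3 / 2 : ℝ)) * Y +
            s2 * ((cK * τ₀) ^ (3 / 2 : ℝ) * V3) * (M ^ (3 / 2 : ℝ) * δ') := by ring
      _ ≤ s2 * Cn * (2 * Kc₆ * N₆ ^ (3 / 2 : ℝ)) * Y +
            s2 * ((cK * τ₀) ^ (3 / 2 : ℝ) * V3) * Y := by gcongr
      _ = P₀ * Y := by rw [hP₀]; ring
  -- ## Hölder for the pressure–velocity term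
  have hHolder : ∫⁻ z, ‖p z.1 z.2 - c z.1‖ₑ * ‖u z.1 z.2‖ₑ ∂μ ≤
      P₀ ^ (2 / 3 : ℝ) * Q₀ ^ (1 / 3 : ℝ) * Y := by
    have hpq : Real.HolderConjugate (3 / 2) 3 := Real.holderConjugate_iff.2 ⟨by norm_num, by norm_num⟩
    have key := ENNReal.lintegral_mul_le_Lp_mul_Lq μ hpq hQm hUm
    have e1 : (∫⁻ z, ‖p z.1 z.2 - c z.1‖ₑ ^ (3 / 2 : ℝ) ∂μ) = PRESS := rfl
    have e2 : (∫⁻ z, ‖u z.1 z.2‖ₑ ^ (3 : ℝ) ∂μ) = CUBE₃ := by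
      rw [hCUBE₃, hμ]
      refine lintegral_congr fun z => ?_
      exact_mod_cast ENNReal.rpow_natCast (‖u z.1 z.2‖ₑ) 3
    simp only [Pi.mul_apply] at key
    rw [e1, e2, show (1 : ℝ) / (3 / 2) = 2 / 3 by norm_num] at key
    calc ∫⁻ z, ‖p z.1 z.2 - c z.1‖ₑ * ‖u z.1 z.2‖ₑ ∂μ
        ≤ PRESS ^ (2 / 3 : ℝ) * CUBE₃ ^ (1 / 3 : ℝ) := key
      _ ≤ (P₀ * Y) ^ (2 / 3 : ℝ) * (Q₀ * Y) ^ (1 / 3 : ℝ) := by gcongr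
      _ = P₀ ^ (2 / 3 : ℝ) * Q₀ ^ (1 / 3 : ℝ) * Y := rpow_twoThirds_mul_rpow_third _ _ _
  -- ## the energy term
  have hT1 : ∫⁻ z, ‖u z.1 z.2‖ₑ ^ 2 ∂μ ≤ N₃ * M * δ' := by
    have hF2 : AEMeasurable (fun z : ℝ × (EuclideanSpace ℝ (Fin 3)) => ‖u z.1 z.2‖ₑ ^ 2) (μt.prod μB) := by
      rw [hμB, hbox]; exact (hvmS B).enorm.pow_const 2
    have e : ∫⁻ z, ‖u z.1 z.2‖ₑ ^ 2 ∂μ = ∫⁻ t, ∫⁻ x, ‖u t x‖ₑ ^ 2 ∂μB ∂μt := by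
      rw [hμ, ← hbox B, ← hμB, lintegral_prod _ hF2]
    rw [e]
    calc ∫⁻ t, ∫⁻ x, ‖u t x‖ₑ ^ 2 ∂μB ∂μt ≤ ∫⁻ _t, N₃ * M ∂μt := by
          refine lintegral_mono_ae ?_
          filter_upwards [hE₃] with t ht
          rw [hμB]; exact ht
      _ = N₃ * M * δ' := by
          rw [lintegral_const, hμt, Measure.restrict_apply_univ, Real.volume_Ioo]
  -- ## assemble
  have hpt : ∀ z : ℝ × (EuclideanSpace ℝ (Fin 3)),
      ‖‖u z.1 z.2‖ ^ 2 * Δ (fun w => radialCutoff 2 3 (y - w)) z.2 +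
          (‖u z.1 z.2‖ ^ 2 + 2 * (p z.1 z.2 - c z.1)) * ⟪u z.1 z.2, gradient (fun w => radialCutoff 2 3 (y - w)) z.2⟫‖ₑ ≤
        ENNReal.ofReal CΔ * ‖u z.1 z.2‖ₑ ^ 2 + ENNReal.ofReal Cg * ‖u z.1 z.2‖ₑ ^ (3 : ℕ) +
          2 * ENNReal.ofReal Cg * (‖p z.1 z.2 - c z.1‖ₑ * ‖u z.1 z.2‖ₑ) := fun z =>
    enorm_flux_le hCΔ0 hCg0 hCΔ hCg y (u z.1 z.2) (p z.1 z.2 - c z.1) z.2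
  have hm1 : AEMeasurable (fun z : ℝ × (EuclideanSpace ℝ (Fin 3)) => ENNReal.ofReal CΔ * ‖u z.1 z.2‖ₑ ^ 2) μ :=
    (hUm.pow_const 2).const_mul _
  have hm2 : AEMeasurable (fun z : ℝ × (EuclideanSpace ℝ (Fin 3)) => ENNReal.ofReal Cg * ‖u z.1 z.2‖ₑ ^ (3 : ℕ)) μ :=
    (hUm.pow_const 3).const_mul _
  have hm3 : AEMeasurable (fun z : ℝ × (EuclideanSpace ℝ (Fin 3)) => ‖p z.1 z.2 - c z.1‖ₑ * ‖u z.1 z.2‖ₑ) μ := hQm.mul hUm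
  have hm12 : AEMeasurable (fun z : ℝ × (EuclideanSpace ℝ (Fin 3)) =>
      ENNReal.ofReal CΔ * ‖u z.1 z.2‖ₑ ^ 2 + ENNReal.ofReal Cg * ‖u z.1 z.2‖ₑ ^ (3 : ℕ)) μ := hm1.add hm2
  calc ∫⁻ z in Ioo t₁ t₂ ×ˢ ball y 3,
          ‖‖u z.1 z.2‖ ^ 2 * Δ (fun w => radialCutoff 2 3 (y - w)) z.2 +
            (‖u z.1 z.2‖ ^ 2 + 2 * (p z.1 z.2 - c z.1)) * ⟪u z.1 z.2, gradient (fun w => radialCutoff 2 3 (y - w)) z.2⟫‖ₑ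
      ≤ ∫⁻ z, (ENNReal.ofReal CΔ * ‖u z.1 z.2‖ₑ ^ 2 + ENNReal.ofReal Cg * ‖u z.1 z.2‖ₑ ^ (3 : ℕ) +
          2 * ENNReal.ofReal Cg * (‖p z.1 z.2 - c z.1‖ₑ * ‖u z.1 z.2‖ₑ)) ∂μ :=
        lintegral_mono fun z => hpt z
    _ = ENNReal.ofReal CΔ * ∫⁻ z, ‖u z.1 z.2‖ₑ ^ 2 ∂μ + ENNReal.ofReal Cg * CUBE₃ +
          2 * ENNReal.ofReal Cg * ∫⁻ z, ‖p z.1 z.2 - c z.1‖ₑ * ‖u z.1 z.2‖ₑ ∂μ := by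
        rw [lintegral_add_left' hm12, lintegral_add_left' hm1,
          lintegral_const_mul' _ _ ENNReal.ofReal_ne_top,
          lintegral_const_mul' _ _ ENNReal.ofReal_ne_top,
          lintegral_const_mul' _ _ (ENNReal.mul_ne_top ENNReal.ofNat_ne_top ENNReal.ofReal_ne_top)]
    _ ≤ ENNReal.ofReal CΔ * (N₃ * M * δ') + ENNReal.ofReal Cg * (Q₀ * Y) +
          2 * ENNReal.ofReal Cg * (P₀ ^ (2 / 3 : ℝ) * Q₀ ^ (1 / 3 : ℝ) * Y) := by
        gcongr
    _ = K₁ * δ' * M + K₂ * M ^ (3 / 2 : ℝ) * δ' ^ (1 / 4 : ℝ) := by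
        rw [hK₁, hK₂, hY]; ring



/-- (Slab form of `JiaSverak2013.exists_window_pressure_bound`, from the raw hypotheses on `(0,S) × ℝ³`.) **The gauged pressure on a time window, closed form**: an absolute `P₀` with
`∫∫_{(t₁,t₂)×B_3(y)} |p - c|^{3/2} ≤ P₀ M^{3/2} (t₂ - t₁)^{1/4}` under the hypotheses of
`exists_window_flux_le` (Jia–Šverák 2013, (2.9): "`sup_{x₀} ∫₀^{λR²}∫_{B_R(x₀)} |p - p(t)|^{3/2} ≤ Cα^{3/2}R^{1/2}`",
before inserting `A(λ) ≤ Cα`). [cite: JiaSverak2013, Lemma 2 (2.9) and its proof (arXiv:1201.1592 pp. 3–4)] -/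
theorem exists_window_pressure_bound_slab :
    ∃ P₀ : ℝ≥0, ∀ {u : ℝ → (EuclideanSpace ℝ (Fin 3)) → (EuclideanSpace ℝ (Fin 3))} {p : ℝ → (EuclideanSpace ℝ (Fin 3)) → ℝ} {S : ℝ}
      (_hvm0 : AEStronglyMeasurable (uncurry u) (volume.restrict (Ioo 0 S ×ˢ (univ : Set (EuclideanSpace ℝ (Fin 3))))))
      (_hπm0 : AEStronglyMeasurable (uncurry p) (volume.restrict (Ioo 0 S ×ˢ (univ : Set (EuclideanSpace ℝ (Fin 3))))))
      (_hcube : ∀ (y : (EuclideanSpace ℝ (Fin 3))) (ρ : ℝ), ∫⁻ z in Ioo 0 S ×ˢ ball y ρ, ‖u z.1 z.2‖ₑ ^ (3 : ℕ) < ⊤)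
      {G : ℝ → (EuclideanSpace ℝ (Fin 3)) → (EuclideanSpace ℝ (Fin 3)) →L[ℝ] (EuclideanSpace ℝ (Fin 3))}
      (_hG : HasWeakSpatialGradientOn (slab (EuclideanSpace ℝ (Fin 3)) (Ioo 0 S) isOpen_Ioo) u G)
      {t₁ t₂ : ℝ} (_h0 : 0 ≤ t₁) (_h12 : t₁ ≤ t₂) (_h2S : t₂ ≤ S) (_hδ1 : t₂ - t₁ ≤ 1) (y : (EuclideanSpace ℝ (Fin 3)))
      {c : ℝ → ℝ} (_hcm : AEStronglyMeasurable c (volume.restrict (Ioo 0 S)))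
      (_hdec : ∀ᵐ z ∂(volume.restrict (Ioo 0 S ×ˢ ball y 3)),
        p z.1 z.2 - c z.1 = localPressureNear y 3 u z.1 z.2 + localPressureFar y 3 u z.1 z.2)
      {E D M : ℝ≥0∞} (_hMtop : M ≠ ⊤) (_hEM : E ≤ M) (_hDM : D ≤ M)
      (_hE : ∀ᵐ t ∂(volume.restrict (Ioo t₁ t₂)), ∀ z : (EuclideanSpace ℝ (Fin 3)), ∫⁻ x in ball z 1, ‖u t x‖ₑ ^ 2 ≤ E)
      (_hD : ∀ z : (EuclideanSpace ℝ (Fin 3)),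
        ∫⁻ w in Ioo t₁ t₂ ×ˢ ball z 1, ENNReal.ofReal (frobeniusNormSq (G w.1 w.2)) ≤ D),
      ∫⁻ z in Ioo t₁ t₂ ×ˢ ball y 3, ‖p z.1 z.2 - c z.1‖ₑ ^ (3 / 2 : ℝ) ≤
        P₀ * M ^ (3 / 2 : ℝ) * ENNReal.ofReal (t₂ - t₁) ^ (1 / 4 : ℝ) := by
  obtain ⟨Cn, -, hCntop, hnear⟩ :=
    exists_lintegral_localPressureNear_le stein1970_normalisedPressure_ae_Lp_bound_holds
  obtain ⟨CK, hCK0, hCK⟩ := exists_abs_pressureKernel_sub_le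
  obtain ⟨Kc₆, hKc₆⟩ := exists_lintegral_cube_window_le_slab (2 * 3)
  -- ## constants
  set V1 : ℝ≥0∞ := volume (ball (0 : (EuclideanSpace ℝ (Fin 3))) 1) with hV1
  set N₆ : ℝ≥0∞ := V1⁻¹ * volume (ball (0 : (EuclideanSpace ℝ (Fin 3))) (2 * 3 + 1)) with hN₆
  set s2 : ℝ≥0∞ := (2 : ℝ≥0∞) ^ (1 / 2 : ℝ) with hs2
  set cK : ℝ≥0∞ := ENNReal.ofReal (CK * 3) with hcK
  set τ₀ : ℝ≥0∞ := V1⁻¹ * (16 * ∫⁻ z in (ball (0 : (EuclideanSpace ℝ (Fin 3))) (2 * 3 - 1))ᶜ, RieszKernel.powKer 4 z)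
    with hτ₀
  set V3 : ℝ≥0∞ := volume (ball (0 : (EuclideanSpace ℝ (Fin 3))) 3) with hV3
  set P₀ : ℝ≥0∞ := s2 * Cn * (2 * Kc₆ * N₆ ^ (3 / 2 : ℝ)) + s2 * ((cK * τ₀) ^ (3 / 2 : ℝ) * V3)
    with hP₀
  -- ## finiteness of the constants
  have hV10 : V1 ≠ 0 := volume_unitBall_ne_zero
  have hV1inv : V1⁻¹ ≠ ⊤ := ENNReal.inv_ne_top.2 hV10
  have hN₆top : N₆ ≠ ⊤ := ENNReal.mul_ne_top hV1inv measure_ball_lt_top.ne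
  have hs2top : s2 ≠ ⊤ := ENNReal.rpow_ne_top_of_nonneg (by norm_num) ENNReal.ofNat_ne_top
  have hτ₀top : τ₀ ≠ ⊤ := by
    refine ENNReal.mul_ne_top hV1inv (ENNReal.mul_ne_top (by norm_num) ?_)
    exact (RieszKernel.lintegral_compl_ball_powKer_lt_top (by norm_num) (by norm_num)).ne
  have hP₀top : P₀ ≠ ⊤ := by
    refine ENNReal.add_ne_top.2 ⟨?_, ?_⟩
    · exact ENNReal.mul_ne_top (ENNReal.mul_ne_top hs2top hCntop)
        (ENNReal.mul_ne_top (ENNReal.mul_ne_top ENNReal.ofNat_ne_top ENNReal.coe_ne_top)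
          (ENNReal.rpow_ne_top_of_nonneg (by norm_num) hN₆top))
    · refine ENNReal.mul_ne_top hs2top (ENNReal.mul_ne_top ?_ measure_ball_lt_top.ne)
      exact ENNReal.rpow_ne_top_of_nonneg (by norm_num)
        (ENNReal.mul_ne_top ENNReal.ofReal_ne_top hτ₀top)
  refine ⟨P₀.toNNReal, ?_⟩
  intro u p S hvm0 hπm0 hcube G hG t₁ t₂ h0 h12 h2S hδ1 y c hcm hdec E D M hMtop hEM hDM hE hD
  rw [ENNReal.coe_toNNReal hP₀top]
  -- ## names
  set δ' : ℝ≥0∞ := ENNReal.ofReal (t₂ - t₁) with hδ'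
  set Y : ℝ≥0∞ := M ^ (3 / 2 : ℝ) * δ' ^ (1 / 4 : ℝ) with hY
  set μt : Measure ℝ := volume.restrict (Ioo t₁ t₂) with hμt
  have hδ'1 : δ' ≤ 1 := ENNReal.ofReal_le_one.2 hδ1
  have hsubI : Ioo t₁ t₂ ⊆ Ioo (0 : ℝ) S := Ioo_subset_Ioo h0 h2S
  -- ## measurability
  have hvm : AEStronglyMeasurable (uncurry u) (volume.restrict (Ioo t₁ t₂ ×ˢ (univ : Set (EuclideanSpace ℝ (Fin 3))))) :=
    hvm0.mono_measure (Measure.restrict_mono (Set.prod_mono hsubI Subset.rfl) le_rfl)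
  have hGm : AEStronglyMeasurable (uncurry G) (volume.restrict (Ioo t₁ t₂ ×ˢ (univ : Set (EuclideanSpace ℝ (Fin 3))))) := by
    have hGw : HasWeakSpatialGradientOn (slab (EuclideanSpace ℝ (Fin 3)) (Ioo t₁ t₂) isOpen_Ioo) u G :=
      hG.mono (slab_mono hsubI)
    exact hGw.locallyIntegrableOn_grad.aestronglyMeasurable
  have hboxu : μt.prod (volume : Measure (EuclideanSpace ℝ (Fin 3))) = volume.restrict (Ioo t₁ t₂ ×ˢ (univ : Set (EuclideanSpace ℝ (Fin 3)))) := by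
    conv_lhs => rw [← Measure.restrict_univ (μ := (volume : Measure (EuclideanSpace ℝ (Fin 3))))]
    rw [hμt, Measure.prod_restrict, ← Measure.volume_eq_prod]
  have hslice_meas : ∀ᵐ t ∂μt, AEStronglyMeasurable (u t) volume := by
    have h1 : AEStronglyMeasurable (uncurry u) (μt.prod (volume : Measure (EuclideanSpace ℝ (Fin 3)))) := by
      rw [hboxu]; exact hvm
    exact h1.prodMk_left
  -- ## radius-6 bounds from the unit-ball bounds
  have hE₆ : ∀ᵐ t ∂μt, ∫⁻ x in ball y (2 * 3), ‖u t x‖ₑ ^ 2 ≤ N₆ * M := by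
    filter_upwards [hslice_meas, hE] with t hmt hEt
    calc ∫⁻ x in ball y (2 * 3), ‖u t x‖ₑ ^ 2 ≤ V1⁻¹ * (E * volume (ball (0 : (EuclideanSpace ℝ (Fin 3))) (2 * 3 + 1))) :=
          setLIntegral_ball_le_of_forall_unitBall (hmt.enorm.pow_const 2) hEt y (2 * 3)
      _ ≤ V1⁻¹ * (M * volume (ball (0 : (EuclideanSpace ℝ (Fin 3))) (2 * 3 + 1))) := by gcongr
      _ = N₆ * M := by rw [hN₆]; ring
  have hFG : AEMeasurable (fun w : ℝ × (EuclideanSpace ℝ (Fin 3)) => ENNReal.ofReal (frobeniusNormSq (G w.1 w.2)))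
      (volume.restrict (Ioo t₁ t₂ ×ˢ (univ : Set (EuclideanSpace ℝ (Fin 3))))) :=
    (continuous_frobeniusNormSq'.comp_aestronglyMeasurable hGm).aemeasurable.ennreal_ofReal
  have hD₆ : ∫⁻ w in Ioo t₁ t₂ ×ˢ ball y (2 * 3), ENNReal.ofReal (frobeniusNormSq (G w.1 w.2)) ≤
      N₆ * M := by
    calc ∫⁻ w in Ioo t₁ t₂ ×ˢ ball y (2 * 3), ENNReal.ofReal (frobeniusNormSq (G w.1 w.2))
        ≤ V1⁻¹ * (D * volume (ball (0 : (EuclideanSpace ℝ (Fin 3))) (2 * 3 + 1))) :=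
          lintegral_box_ball_le_of_forall_unitBall hFG hD y (2 * 3)
      _ ≤ V1⁻¹ * (M * volume (ball (0 : (EuclideanSpace ℝ (Fin 3))) (2 * 3 + 1))) := by gcongr
      _ = N₆ * M := by rw [hN₆]; ring
  -- ## the cubic functional on the box of radius `6`
  have hN₆Mtop : N₆ * M ≠ ⊤ := ENNReal.mul_ne_top hN₆top hMtop
  set CUBE₆ : ℝ≥0∞ := ∫⁻ z in Ioo t₁ t₂ ×ˢ ball y (2 * 3), ‖u z.1 z.2‖ₑ ^ (3 : ℕ) with hCUBE₆
  have hC₆ : CUBE₆ ≤ (2 * Kc₆ * N₆ ^ (3 / 2 : ℝ)) * Y := by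
    have h := hKc₆ u G S t₁ t₂ y (N₆ * M) h0 h12 h2S hδ1 hN₆Mtop hG hE₆ hD₆
    refine h.trans (le_of_eq ?_)
    rw [hY, ENNReal.mul_rpow_of_nonneg _ _ (by norm_num : (0:ℝ) ≤ 3 / 2)]
    ring
  -- ## the gauged pressure
  have h := lintegral_window_pressure_le_slab hnear hCK0 hCK hvm0 hπm0 h0 h12 h2S y (hcube y (2 * 3)) hcm hdec hE
  refine h.trans ?_
  have hTail : (cK * (V1⁻¹ * (E * (16 * ∫⁻ z in (ball (0 : (EuclideanSpace ℝ (Fin 3))) (2 * 3 - 1))ᶜ,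
      RieszKernel.powKer 4 z)))) ^ (3 / 2 : ℝ) ≤ (cK * τ₀) ^ (3 / 2 : ℝ) * M ^ (3 / 2 : ℝ) := by
    rw [← ENNReal.mul_rpow_of_nonneg _ _ (by norm_num : (0:ℝ) ≤ 3 / 2)]
    refine ENNReal.rpow_le_rpow ?_ (by norm_num)
    calc cK * (V1⁻¹ * (E * (16 * ∫⁻ z in (ball (0 : (EuclideanSpace ℝ (Fin 3))) (2 * 3 - 1))ᶜ, RieszKernel.powKer 4 z)))
        = cK * τ₀ * E := by rw [hτ₀]; ring
      _ ≤ cK * τ₀ * M := by gcongr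
  have hδY : M ^ (3 / 2 : ℝ) * δ' ≤ Y := by
    rw [hY]
    gcongr
    conv_lhs => rw [← ENNReal.rpow_one δ']
    exact ENNReal.rpow_le_rpow_of_exponent_ge hδ'1 (by norm_num)
  calc s2 * Cn * CUBE₆ + s2 * ((cK * (V1⁻¹ * (E * (16 * ∫⁻ z in (ball (0 : (EuclideanSpace ℝ (Fin 3))) (2 * 3 - 1))ᶜ,
          RieszKernel.powKer 4 z)))) ^ (3 / 2 : ℝ) * V3) * δ'
      ≤ s2 * Cn * ((2 * Kc₆ * N₆ ^ (3 / 2 : ℝ)) * Y) +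
          s2 * (((cK * τ₀) ^ (3 / 2 : ℝ) * M ^ (3 / 2 : ℝ)) * V3) * δ' := by gcongr
    _ = s2 * Cn * (2 * Kc₆ * N₆ ^ (3 / 2 : ℝ)) * Y +
          s2 * ((cK * τ₀) ^ (3 / 2 : ℝ) * V3) * (M ^ (3 / 2 : ℝ) * δ') := by ring
    _ ≤ s2 * Cn * (2 * Kc₆ * N₆ ^ (3 / 2 : ℝ)) * Y +
          s2 * ((cK * τ₀) ^ (3 / 2 : ℝ) * V3) * Y := by gcongr
    _ = P₀ * Y := by rw [hP₀]; ring
    _ = P₀ * M ^ (3 / 2 : ℝ) * δ' ^ (1 / 4 : ℝ) := by rw [hY]; ring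


/-! ### The core estimate and Lemma 3.1 at unit scale, slab class -/

/-- (Slab form of `JiaSverak2013.core_bounds`: the solution is a local Leray solution on `(0,T_sl) × ℝ³`, `T ≤ T_sl`, the class bounds are taken on `(0, T_sl)` and the local energy inequality from `t = 0` is the slab one, `IsLocalLeraySolutionOn.ae_lintegral_sq_mul_add_grad_le_datum_add`.) **The core of the a priori estimate (unit scale, fixed threshold).** Let `(u, p)` be a local
Leray solution with `E²` datum `u₀` and weak gradient `G`; let `K₁, K₂` bound the flux of the
local energy inequality on every time window as in `exists_window_flux_le`; let `c_y` be
measurable gauges for the pressure at every centre (`exists_measurable_gauge`). Let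
`0 < T ≤ 1/2` and `θ > 0` be such that (i) `K₁ s θ + K₂ θ^{3/2} s^{1/4} ≤ θ/4` for all
`s ∈ [0, T]` (the smallness of the time, from `T ≤ ε₀ min{α⁻², 1}`) and (ii)
`∫ |u₀|² φ_y ≤ θ/4` for all `y` (the size of the datum). Then the unit-ball energies of `u(t)`
are `≤ θ` for a.e. `t ∈ (0, T)` and the unit-ball dissipations on `(0, T)` are `≤ θ/2`.
This is Jia–Šverák's "continuation in `λ`" (proof of Lemma 2: "From the above estimate for
`A(λ)`, the lemma follows easily by the usual continuation in `λ` argument") made discrete: on a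
grid `s_k = kT/n` fine enough that the flux over one step, bounded through the (finite, class)
uniformly local bounds of the solution, is `≤ θ/4`, the bound `e_y + 2d_y ≤ θ/4 + θ/2` propagates
from `(0, s_k)` to `(0, s_{k+1})` by the local energy inequality from the initial time
(`IsLocalLeraySolution.ae_lintegral_sq_mul_add_grad_le_datum_add`) tested with `φ_y` at the
integer lattice of centres `y`. [cite: JiaSverak2013, proof of Lemma 2 (arXiv:1201.1592 pp. 3–4)] -/
theorem core_bounds_slab
    {u₀ : (EuclideanSpace ℝ (Fin 3)) → (EuclideanSpace ℝ (Fin 3))} {u : ℝ → (EuclideanSpace ℝ (Fin 3)) → (EuclideanSpace ℝ (Fin 3))} {p : ℝ → (EuclideanSpace ℝ (Fin 3)) → ℝ} {G : ℝ → (EuclideanSpace ℝ (Fin 3)) → (EuclideanSpace ℝ (Fin 3)) →L[ℝ] (EuclideanSpace ℝ (Fin 3))}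
    {Tsl : ℝ} (hv : IsLocalLeraySolutionOn Tsl 1 u₀ u p) (hm₀ : AEStronglyMeasurable u₀ volume)
    (hG : HasWeakSpatialGradientOn (slab (EuclideanSpace ℝ (Fin 3)) (Ioo 0 Tsl) isOpen_Ioo) u G)
    {K₁ K₂ : ℝ≥0}
    (hflux : ∀ {t₁ t₂ : ℝ} (_h0 : 0 ≤ t₁) (_h12 : t₁ ≤ t₂) (_h2S : t₂ ≤ Tsl) (_hδ1 : t₂ - t₁ ≤ 1)
      (y : (EuclideanSpace ℝ (Fin 3))) {c : ℝ → ℝ} (_hcm : AEStronglyMeasurable c (volume.restrict (Ioo 0 Tsl)))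
      (_hdec : ∀ᵐ z ∂(volume.restrict (Ioo 0 Tsl ×ˢ ball y 3)),
        p z.1 z.2 - c z.1 = localPressureNear y 3 u z.1 z.2 + localPressureFar y 3 u z.1 z.2)
      {E D M : ℝ≥0∞} (_hMtop : M ≠ ⊤) (_hEM : E ≤ M) (_hDM : D ≤ M)
      (_hE : ∀ᵐ t ∂(volume.restrict (Ioo t₁ t₂)), ∀ z : (EuclideanSpace ℝ (Fin 3)), ∫⁻ x in ball z 1, ‖u t x‖ₑ ^ 2 ≤ E)
      (_hD : ∀ z : (EuclideanSpace ℝ (Fin 3)),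
        ∫⁻ w in Ioo t₁ t₂ ×ˢ ball z 1, ENNReal.ofReal (frobeniusNormSq (G w.1 w.2)) ≤ D),
      ∫⁻ z in Ioo t₁ t₂ ×ˢ ball y 3,
          ‖‖u z.1 z.2‖ ^ 2 * Δ (fun w => radialCutoff 2 3 (y - w)) z.2 +
            (‖u z.1 z.2‖ ^ 2 + 2 * (p z.1 z.2 - c z.1)) *
              ⟪u z.1 z.2, gradient (fun w => radialCutoff 2 3 (y - w)) z.2⟫‖ₑ ≤
        K₁ * ENNReal.ofReal (t₂ - t₁) * M + K₂ * M ^ (3 / 2 : ℝ) * ENNReal.ofReal (t₂ - t₁) ^ (1 / 4 : ℝ))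
    (cg : (EuclideanSpace ℝ (Fin 3)) → ℝ → ℝ) (hcgm : ∀ y, Measurable (cg y))
    (hcgL : ∀ y, MemLp (cg y) (3 / 2 : ℝ≥0∞) (volume.restrict (Ioo 0 Tsl)))
    (hcgdec : ∀ y, ∀ᵐ z ∂(volume.restrict (Ioo 0 Tsl ×ˢ ball y 3)),
        p z.1 z.2 - cg y z.1 = localPressureNear y 3 u z.1 z.2 + localPressureFar y 3 u z.1 z.2)
    (hcgfin : ∀ y, ∀ R : ℝ, 0 < R →
        ∫⁻ z in Ioo 0 Tsl ×ˢ ball (0 : (EuclideanSpace ℝ (Fin 3))) R, ‖p z.1 z.2 - cg y z.1‖ₑ ^ (3 / 2 : ℝ) < ⊤)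
    {T : ℝ} (hT : 0 < T) (hTsl : T ≤ Tsl) (hT1 : T ≤ 1 / 2) {θ : ℝ≥0} (hθ : 0 < θ)
    (hA : ∀ s : ℝ, 0 ≤ s → s ≤ T →
      (K₁ : ℝ≥0∞) * ENNReal.ofReal s * (θ : ℝ≥0∞) +
          (K₂ : ℝ≥0∞) * (θ : ℝ≥0∞) ^ (3 / 2 : ℝ) * (ENNReal.ofReal s) ^ (1 / 4 : ℝ) ≤
        ((θ / 4 : ℝ≥0) : ℝ≥0∞))
    (ha : ∀ y : (EuclideanSpace ℝ (Fin 3)), ∫⁻ x, ‖u₀ x‖ₑ ^ 2 * ENNReal.ofReal (radialCutoff 2 3 (y - x)) ≤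
      ((θ / 4 : ℝ≥0) : ℝ≥0∞)) :
    (∀ᵐ t ∂(volume.restrict (Ioo 0 T)), ∀ z : (EuclideanSpace ℝ (Fin 3)), ∫⁻ x in ball z 1, ‖u t x‖ₑ ^ 2 ≤ (θ : ℝ≥0∞)) ∧
    ∀ z : (EuclideanSpace ℝ (Fin 3)), ∫⁻ w in Ioo 0 T ×ˢ ball z 1, ENNReal.ofReal (frobeniusNormSq (G w.1 w.2)) ≤
      ((θ / 2 : ℝ≥0) : ℝ≥0∞) := by
  -- ## names
  set L : (Fin 3 → ℤ) → (EuclideanSpace ℝ (Fin 3)) := fun k => (WithLp.equiv 2 (Fin 3 → ℝ)).symm fun i => (k i : ℝ) with hL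
  set e : (EuclideanSpace ℝ (Fin 3)) → ℝ → ℝ≥0∞ := fun y t => ∫⁻ x, ‖u t x‖ₑ ^ 2 * ENNReal.ofReal (radialCutoff 2 3 (y - x))
    with he
  set d : (EuclideanSpace ℝ (Fin 3)) → ℝ → ℝ≥0∞ := fun y s => ∫⁻ z in Ioo 0 s ×ˢ ball (0 : (EuclideanSpace ℝ (Fin 3))) (‖y‖ + 4),
    ENNReal.ofReal (frobeniusNormSq (G z.1 z.2)) * ENNReal.ofReal (radialCutoff 2 3 (y - z.2)) with hd
  set F : (EuclideanSpace ℝ (Fin 3)) → ℝ × (EuclideanSpace ℝ (Fin 3)) → ℝ≥0∞ := fun y z =>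
    ‖‖u z.1 z.2‖ ^ 2 * Δ (fun w => radialCutoff 2 3 (y - w)) z.2 +
      (‖u z.1 z.2‖ ^ 2 + 2 * (p z.1 z.2 - cg y z.1)) *
        ⟪u z.1 z.2, gradient (fun w => radialCutoff 2 3 (y - w)) z.2⟫‖ₑ with hF
  set R : (EuclideanSpace ℝ (Fin 3)) → ℝ → ℝ → ℝ≥0∞ := fun y a b => ∫⁻ z in Ioo a b ×ˢ ball y 3, F y z with hR
  set θ' : ℝ≥0∞ := (θ : ℝ≥0∞) with hθ'
  set θ4 : ℝ≥0∞ := ((θ / 4 : ℝ≥0) : ℝ≥0∞) with hθ4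
  set θ2 : ℝ≥0∞ := ((θ / 2 : ℝ≥0) : ℝ≥0∞) with hθ2
  have hTsl0 : 0 < Tsl := hT.trans_le hTsl
  have hcgAEm : ∀ y, AEStronglyMeasurable (cg y) (volume.restrict (Ioo 0 Tsl)) := fun y =>
    (hcgm y).aestronglyMeasurable
  -- ## the a priori (class) bounds of the solution on `(0, Tsl)`
  obtain ⟨A₁, hA₁⟩ := hv.uniformLocalEnergy 1 one_pos
  obtain ⟨G', hG', hG'b⟩ := hv.uniformLocalGradient
  obtain ⟨A₂, hA₂⟩ := hG'b 1 one_pos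
  have hGG' : ∀ᵐ z ∂(volume.restrict (Ioo (0 : ℝ) Tsl ×ˢ (univ : Set (EuclideanSpace ℝ (Fin 3))))), uncurry G z = uncurry G' z :=
    hG.ae_eq hG'
  have hA₂G : ∀ x₀ : (EuclideanSpace ℝ (Fin 3)), ∫⁻ z in Ioo 0 Tsl ×ˢ ball x₀ 1, ENNReal.ofReal (frobeniusNormSq (G z.1 z.2)) ≤ A₂ := by
    intro x₀
    have hsub : Ioo (0 : ℝ) Tsl ×ˢ ball x₀ 1 ⊆ Ioo 0 Tsl ×ˢ univ := Set.prod_mono Subset.rfl (subset_univ _)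
    have h1 := ae_restrict_of_ae_restrict_of_subset hsub hGG'
    calc ∫⁻ z in Ioo 0 Tsl ×ˢ ball x₀ 1, ENNReal.ofReal (frobeniusNormSq (G z.1 z.2))
        = ∫⁻ z in Ioo 0 Tsl ×ˢ ball x₀ 1, ENNReal.ofReal (frobeniusNormSq (G' z.1 z.2)) := by
          refine lintegral_congr_ae ?_
          filter_upwards [h1] with z hz
          have hz' : G z.1 z.2 = G' z.1 z.2 := hz
          rw [hz']
      _ ≤ A₂ := hA₂ x₀
  set Mb : ℝ≥0 := max A₁ A₂ with hMb
  -- ## smallness on short windows and the grid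
  obtain ⟨δ₀, hδ₀, hδ₀1, hB⟩ := exists_window_small K₁ K₂ Mb θ hθ
  set n : ℕ := ⌈T / δ₀⌉₊ with hn
  have hnpos : 0 < n := Nat.ceil_pos.2 (div_pos hT hδ₀)
  have hnR : (0 : ℝ) < n := by exact_mod_cast hnpos
  set δ : ℝ := T / n with hδ
  have hδpos : 0 < δ := div_pos hT hnR
  have hδδ₀ : δ ≤ δ₀ := by
    rw [hδ, div_le_iff₀ hnR]
    have h1 : T / δ₀ ≤ n := Nat.le_ceil _
    rw [div_le_iff₀ hδ₀] at h1
    linarith [mul_comm δ₀ (n : ℝ)]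
  have hδ1 : δ ≤ 1 := hδδ₀.trans hδ₀1
  have hnδ : (n : ℝ) * δ = T := by rw [hδ]; field_simp
  -- ## the local energy inequality from `t = 0`, tested with `φ_y`, gauge `c_y`
  have hEI : ∀ y : (EuclideanSpace ℝ (Fin 3)), ∀ᵐ s' ∂(volume.restrict (Ioo 0 Tsl)),
      e y s' + 2 * d y s' ≤ (∫⁻ x, ‖u₀ x‖ₑ ^ 2 * ENNReal.ofReal (radialCutoff 2 3 (y - x))) +
        ∫⁻ z in Ioo 0 s' ×ˢ ball (0 : (EuclideanSpace ℝ (Fin 3))) (‖y‖ + 4), F y z := by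
    intro y
    have hvy : IsLocalLeraySolutionOn Tsl 1 u₀ u (fun t x => p t x - cg y t) :=
      hv.sub_pressure (hcgm y) (hcgL y) (hcgfin y)
    exact hvy.ae_lintegral_sq_mul_add_grad_le_datum_add hm₀ hG hTsl0 le_rfl
      (contDiff_testFn y) (tsupport_testFn_subset_ball y) (testFn_nonneg y)
  -- the flux integrand vanishes off `B̄_3(y)`: restriction of the flux to `(0,s') × B_3(y)`
  have hFR : ∀ (y : (EuclideanSpace ℝ (Fin 3))) (s' : ℝ), ∫⁻ z in Ioo 0 s' ×ˢ ball (0 : (EuclideanSpace ℝ (Fin 3))) (‖y‖ + 4), F y z ≤ R y 0 s' := by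
    intro y s'
    have h1 : ∫⁻ z in Ioo 0 s' ×ˢ ball (0 : (EuclideanSpace ℝ (Fin 3))) (‖y‖ + 4), F y z ≤ ∫⁻ z in Ioo 0 s' ×ˢ closedBall y 3, F y z := by
      refine setLIntegral_prod_le_of_eq_zero_off measurableSet_closedBall fun z hz => ?_
      simp only [hF]
      rw [laplacian_testFn_eq_zero hz, gradient_testFn_eq_zero hz, inner_zero_right, mul_zero,
        mul_zero, add_zero, enorm_zero]
    exact h1.trans (setLIntegral_prod_closedBall_eq _ _ _ _).le
  -- ## the induction over the grid
  have hgrid : ∀ k : ℕ, k ≤ n →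
      (∀ᵐ t ∂(volume.restrict (Ioo 0 ((k : ℝ) * δ))), ∀ κ : Fin 3 → ℤ, e (L κ) t ≤ θ') ∧
      (∀ κ : Fin 3 → ℤ, d (L κ) ((k : ℝ) * δ) ≤ θ2) := by
    intro k
    induction k with
    | zero =>
      intro _
      refine ⟨?_, fun κ => ?_⟩
      · simp only [Nat.cast_zero, zero_mul, Ioo_self, Measure.restrict_empty, ae_zero, eventually_bot]
      · simp only [hd, Nat.cast_zero, zero_mul, Ioo_self, Set.empty_prod, Measure.restrict_empty,
          lintegral_zero_measure, zero_le]
    | succ k ih =>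
      intro hk
      have ihk := ih (Nat.le_of_succ_le hk)
      set sk : ℝ := (k : ℝ) * δ with hsk_def
      set sk1 : ℝ := ((k + 1 : ℕ) : ℝ) * δ with hsk1_def
      have hsk0 : 0 ≤ sk := by rw [hsk_def]; positivity
      have hwin : sk1 - sk = δ := by rw [hsk1_def, hsk_def]; push_cast; ring
      have hsk : sk ≤ sk1 := by linarith
      have hsk1T : sk1 ≤ T := by
        rw [hsk1_def, ← hnδ]
        have : ((k + 1 : ℕ) : ℝ) ≤ n := by exact_mod_cast hk
        exact mul_le_mul_of_nonneg_right this hδpos.le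
      have hskT : sk ≤ T := hsk.trans hsk1T
      have hsk1pos : 0 < sk1 := by rw [hsk1_def]; positivity
      -- unit-ball bounds on `(0, sk)` from the induction hypothesis
      have HE : ∀ᵐ t ∂(volume.restrict (Ioo 0 sk)), ∀ z : (EuclideanSpace ℝ (Fin 3)), ∫⁻ x in ball z 1, ‖u t x‖ₑ ^ 2 ≤ θ' := by
        filter_upwards [ihk.1] with t ht z
        obtain ⟨κ, hκ⟩ := exists_lattice_dist_lt z
        exact (lintegral_ball_le_lintegral_mul_cutoff hκ).trans (ht κ)
      have HD : ∀ z : (EuclideanSpace ℝ (Fin 3)), ∫⁻ w in Ioo 0 sk ×ˢ ball z 1, ENNReal.ofReal (frobeniusNormSq (G w.1 w.2)) ≤ θ' := by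
        intro z
        obtain ⟨κ, hκ⟩ := exists_lattice_dist_lt z
        exact (lintegral_box_ball_le_box_mul_cutoff hκ 0 sk).trans ((ihk.2 κ).trans (coe_half_le θ))
      -- the flux over `(0, sk)`: the smallness of the time
      have hR1 : ∀ y : (EuclideanSpace ℝ (Fin 3)), R y 0 sk ≤ θ4 := by
        intro y
        have h := hflux le_rfl hsk0 (hskT.trans hTsl) (by linarith) y (hcgAEm y) (hcgdec y)
          (E := θ') (D := θ') (M := θ') ENNReal.coe_ne_top le_rfl le_rfl HE HD
        rw [sub_zero] at h
        exact h.trans (hA sk hsk0 hskT)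
      -- the flux over `(sk, sk1)`: the smallness of the step
      have hR2 : ∀ y : (EuclideanSpace ℝ (Fin 3)), R y sk sk1 ≤ θ4 := by
        intro y
        have hE' : ∀ᵐ t ∂(volume.restrict (Ioo sk sk1)), ∀ z : (EuclideanSpace ℝ (Fin 3)),
            ∫⁻ x in ball z 1, ‖u t x‖ₑ ^ 2 ≤ (A₁ : ℝ≥0∞) :=
          ae_restrict_of_ae_restrict_of_subset (Ioo_subset_Ioo hsk0 (hsk1T.trans hTsl)) hA₁
        have hD' : ∀ z : (EuclideanSpace ℝ (Fin 3)), ∫⁻ w in Ioo sk sk1 ×ˢ ball z 1,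
            ENNReal.ofReal (frobeniusNormSq (G w.1 w.2)) ≤ (A₂ : ℝ≥0∞) := fun z =>
          (lintegral_mono_set (Set.prod_mono (Ioo_subset_Ioo hsk0 (hsk1T.trans hTsl)) Subset.rfl)).trans
            (hA₂G z)
        have h := hflux hsk0 hsk (hsk1T.trans hTsl) (by rw [hwin]; exact hδ1) y (hcgAEm y)
          (hcgdec y) (E := (A₁ : ℝ≥0∞)) (D := (A₂ : ℝ≥0∞)) (M := (Mb : ℝ≥0∞))
          ENNReal.coe_ne_top (ENNReal.coe_le_coe.2 (le_max_left _ _))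
          (ENNReal.coe_le_coe.2 (le_max_right _ _)) hE' hD'
        rw [hwin] at h
        exact h.trans (hB δ hδpos.le hδδ₀)
      have hRsum : ∀ y : (EuclideanSpace ℝ (Fin 3)), R y 0 sk1 ≤ θ2 := fun y =>
        (setLIntegral_prod_Ioo_le_add (b := sk) _ _).trans (by
          rw [hθ2, ← coe_quarter_add_quarter]
          exact add_le_add (hR1 y) (hR2 y))
      -- the local energy inequality on `(0, sk1)`
      have hmain : ∀ y : (EuclideanSpace ℝ (Fin 3)), ∀ᵐ s' ∂(volume.restrict (Ioo 0 sk1)), e y s' + 2 * d y s' ≤ θ4 + θ2 := by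
        intro y
        have h1 := ae_restrict_of_ae_restrict_of_subset (Ioo_subset_Ioo le_rfl (hsk1T.trans hTsl)) (hEI y)
        have h2 : ∀ᵐ s' ∂(volume.restrict (Ioo 0 sk1)), s' ∈ Ioo 0 sk1 := ae_restrict_mem measurableSet_Ioo
        filter_upwards [h1, h2] with s' hs' hs'mem
        calc e y s' + 2 * d y s'
            ≤ (∫⁻ x, ‖u₀ x‖ₑ ^ 2 * ENNReal.ofReal (radialCutoff 2 3 (y - x))) +
                ∫⁻ z in Ioo 0 s' ×ˢ ball (0 : (EuclideanSpace ℝ (Fin 3))) (‖y‖ + 4), F y z := hs'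
          _ ≤ θ4 + R y 0 sk1 := add_le_add (ha y) ((hFR y s').trans
              (lintegral_mono_set (Set.prod_mono (Ioo_subset_Ioo le_rfl hs'mem.2.le) Subset.rfl)))
          _ ≤ θ4 + θ2 := add_le_add le_rfl (hRsum y)
      refine ⟨?_, fun κ => ?_⟩
      · rw [hsk1_def] at hmain
        refine ae_all_iff.2 fun κ => ?_
        filter_upwards [hmain (L κ)] with t ht
        exact (le_self_add.trans ht).trans (coe_quarter_add_half_le θ)
      · refine setLIntegral_prod_le_of_ae hsk1pos ?_
        filter_upwards [hmain (L κ)] with s' hs'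
        exact le_coe_half_of_two_mul_le θ (le_add_self.trans hs')
  -- ## conclusion at `s_n = T`
  obtain ⟨h1, h2⟩ := hgrid n le_rfl
  rw [hnδ] at h1 h2
  refine ⟨?_, fun z => ?_⟩
  · filter_upwards [h1] with t ht z
    obtain ⟨κ, hκ⟩ := exists_lattice_dist_lt z
    exact (lintegral_ball_le_lintegral_mul_cutoff hκ).trans (ht κ)
  · obtain ⟨κ, hκ⟩ := exists_lattice_dist_lt z
    exact (lintegral_box_ball_le_box_mul_cutoff hκ 0 T).trans (h2 κ)


/-- (Slab form of `JiaSverak2013.apriori_unit_scale` = **Jia–Šverák 2014, Lemma 3.1** at `R = 1` for Leray solutions given on a finite slab `(0, T_sl) × ℝ³` only, `T ≤ T_sl`; the gauges are the slab ones of `IsLocalLeraySolutionOn.exists_measurable_gauge`, and neither `u₀ ∈ E²` nor `div u₀ = 0` is needed beyond the measurability of `u₀`.) **Jia–Šverák's Lemma 2 at unit radius** (`R = 1`; the general radius follows by the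
Navier–Stokes scaling, `jia_sverak_2013_lemma_2_holds`): there are absolute `ε₀ ∈ (0, 1]` and
`C` such that for every weakly divergence-free `u₀ ∈ E²` with `∫_{B_1(x₀)} |u₀|² ≤ 2α` for all
`x₀`, every local Leray solution `(u, p)` with datum `u₀`, every weak spatial gradient `G` of `u`,
and every `0 < T ≤ ε₀` with `Tα² ≤ ε₀`: `∫_{B_1(x₀)} |u(t)|² ≤ 2Cα` for a.e. `t ∈ (0,T)` and all
`x₀`, `∫∫_{(0,T)×B_1(x₀)} |G|² ≤ Cα`, and at every centre a measurable gauge `c` with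
`∫∫_{(0,T)×B_1(x₀)} |p - c|^{3/2} ≤ Cα^{3/2}`. Proof: the core estimate `core_bounds` with
thresholds `θ = 8nα + η`, `η ↓ 0` (`n = |B_1|⁻¹|B_5|`, so that `∫|u₀|²φ_y ≤ 2nα = θ/4 - η/4`), the
smallness `K₁sθ + K₂θ^{3/2}s^{1/4} ≤ θ/4` for `s ≤ T` coming from `T ≤ ε₀`, `Tα² ≤ ε₀`
(`small_hyps`, `window_bound_le_quarter`); the pressure bound is `exists_window_pressure_bound`
on `(0, T)` with `M = 8nα`. [cite: JiaSverak2013, Lemma 2 with (2.7), (2.9) and its proof (arXiv:1201.1592 pp. 3–4)] -/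
theorem apriori_unit_scale_slab :
    ∃ ε₀ : ℝ≥0, 0 < ε₀ ∧ ε₀ ≤ 1 ∧ ∃ C : ℝ≥0,
    ∀ (u₀ : (EuclideanSpace ℝ (Fin 3)) → (EuclideanSpace ℝ (Fin 3))) (u : ℝ → (EuclideanSpace ℝ (Fin 3)) → (EuclideanSpace ℝ (Fin 3))) (p : ℝ → (EuclideanSpace ℝ (Fin 3)) → ℝ) (G : ℝ → (EuclideanSpace ℝ (Fin 3)) → (EuclideanSpace ℝ (Fin 3)) →L[ℝ] (EuclideanSpace ℝ (Fin 3)))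
      (α : ℝ≥0) (Tsl T : ℝ),
      AEStronglyMeasurable u₀ volume → IsLocalLeraySolutionOn Tsl 1 u₀ u p →
      HasWeakSpatialGradientOn (slab (EuclideanSpace ℝ (Fin 3)) (Ioo 0 Tsl) isOpen_Ioo) u G →
      (∀ x₀ : (EuclideanSpace ℝ (Fin 3)), ∫⁻ x in ball x₀ 1, ‖u₀ x‖ₑ ^ 2 ≤ 2 * (α : ℝ≥0∞)) →
      0 < T → T ≤ Tsl → T ≤ (ε₀ : ℝ) → T * (α : ℝ) ^ 2 ≤ (ε₀ : ℝ) →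
      (∀ᵐ t ∂(volume.restrict (Ioo 0 T)), ∀ x₀ : (EuclideanSpace ℝ (Fin 3)),
          ∫⁻ x in ball x₀ 1, ‖u t x‖ₑ ^ 2 ≤ 2 * ((C * α : ℝ≥0) : ℝ≥0∞)) ∧
      (∀ x₀ : (EuclideanSpace ℝ (Fin 3)), ∫⁻ z in Ioo 0 T ×ˢ ball x₀ 1, ENNReal.ofReal (frobeniusNormSq (G z.1 z.2)) ≤
          ((C * α : ℝ≥0) : ℝ≥0∞)) ∧
      ∀ x₀ : (EuclideanSpace ℝ (Fin 3)), ∃ c : ℝ → ℝ, Measurable c ∧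
        ∫⁻ z in Ioo 0 T ×ˢ ball x₀ 1, ‖p z.1 z.2 - c z.1‖ₑ ^ (3 / 2 : ℝ) ≤
          ((C * (α * NNReal.sqrt α) : ℝ≥0) : ℝ≥0∞) := by
  obtain ⟨K₁, K₂, hK⟩ := exists_window_flux_le_slab
  obtain ⟨P₀, hP⟩ := exists_window_pressure_bound_slab
  -- the covering number of radius `4`
  set N : ℝ≥0∞ := (volume (ball (0 : (EuclideanSpace ℝ (Fin 3))) 1))⁻¹ * volume (ball (0 : (EuclideanSpace ℝ (Fin 3))) (4 + 1)) with hN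
  have hNtop : N ≠ ⊤ :=
    ENNReal.mul_ne_top (ENNReal.inv_ne_top.2 volume_unitBall_ne_zero) measure_ball_lt_top.ne
  set n₅ : ℝ≥0 := N.toNNReal with hn₅
  have hn₅N : (n₅ : ℝ≥0∞) = N := ENNReal.coe_toNNReal hNtop
  -- ## the constants
  set ε₀ : ℝ≥0 := min (1 / 2) (min (1 / (8 * K₁ + 1)) (1 / (8 ^ 4 * K₂ ^ 4 * (128 * n₅ ^ 2 + 2) + 1)))
    with hε₀
  have hε₀pos : 0 < ε₀ := by rw [hε₀]; positivity
  have hε₀half : ε₀ ≤ 1 / 2 := min_le_left _ _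
  have hε1 : 8 * K₁ * ε₀ ≤ 1 := by
    have h1 : ε₀ ≤ 1 / (8 * K₁ + 1) := (min_le_right _ _).trans (min_le_left _ _)
    calc 8 * K₁ * ε₀ ≤ (8 * K₁ + 1) * (1 / (8 * K₁ + 1)) := by gcongr; exact le_self_add
      _ = 1 := mul_one_div_cancel (by positivity)
  have hε2 : 8 ^ 4 * K₂ ^ 4 * (128 * n₅ ^ 2 + 2) * ε₀ ≤ 1 := by
    have h1 : ε₀ ≤ 1 / (8 ^ 4 * K₂ ^ 4 * (128 * n₅ ^ 2 + 2) + 1) :=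
      (min_le_right _ _).trans (min_le_right _ _)
    calc 8 ^ 4 * K₂ ^ 4 * (128 * n₅ ^ 2 + 2) * ε₀
        ≤ (8 ^ 4 * K₂ ^ 4 * (128 * n₅ ^ 2 + 2) + 1) * (1 / (8 ^ 4 * K₂ ^ 4 * (128 * n₅ ^ 2 + 2) + 1)) := by
          gcongr; exact le_self_add
      _ = 1 := mul_one_div_cancel (by positivity)
  set C : ℝ≥0 := max (4 * n₅) (24 * P₀ * (n₅ * NNReal.sqrt n₅)) with hC
  refine ⟨ε₀, hε₀pos, hε₀half.trans (by norm_num), C, ?_⟩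
  intro u₀ u p G α Tsl T hm₀ hv hG hα hT hTsl hTε hTα
  have hvm0 := hv.aestronglyMeasurable
  have hπm0 := hv.aestronglyMeasurable_pressure
  have hcube : ∀ (y : (EuclideanSpace ℝ (Fin 3))) (ρ : ℝ),
      ∫⁻ z in Ioo 0 Tsl ×ˢ ball y ρ, ‖u z.1 z.2‖ₑ ^ (3 : ℕ) < ⊤ := fun y ρ =>
    hv.lintegral_cube_box_lt_top y ρ
  have hT1 : T ≤ 1 / 2 := hTε.trans (by exact_mod_cast hε₀half)
  have hT1' : T ≤ 1 := hT1.trans (by norm_num)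
  -- ## gauges at every centre
  have hg : ∀ y : (EuclideanSpace ℝ (Fin 3)), ∃ c : ℝ → ℝ, Measurable c ∧
      MemLp c (3 / 2 : ℝ≥0∞) (volume.restrict (Ioo 0 Tsl)) ∧
      (∀ᵐ z ∂(volume.restrict (Ioo 0 Tsl ×ˢ ball y 3)),
        p z.1 z.2 - c z.1 = localPressureNear y 3 u z.1 z.2 + localPressureFar y 3 u z.1 z.2) ∧
      ∀ R : ℝ, 0 < R →
        ∫⁻ z in Ioo 0 Tsl ×ˢ ball (0 : (EuclideanSpace ℝ (Fin 3))) R, ‖p z.1 z.2 - c z.1‖ₑ ^ (3 / 2 : ℝ) < ⊤ :=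
    fun y => hv.exists_measurable_gauge y
  choose cg hcgm hcgL hcgdec hcgfin using hg
  -- ## the datum: `∫ |u₀|² φ_y ≤ 2 n₅ α`
  have ha0 : ∀ y : (EuclideanSpace ℝ (Fin 3)), ∫⁻ x, ‖u₀ x‖ₑ ^ 2 * ENNReal.ofReal (radialCutoff 2 3 (y - x)) ≤
      ((2 * n₅ * α : ℝ≥0) : ℝ≥0∞) := by
    intro y
    calc ∫⁻ x, ‖u₀ x‖ₑ ^ 2 * ENNReal.ofReal (radialCutoff 2 3 (y - x))
        ≤ ∫⁻ x in ball y 4, ‖u₀ x‖ₑ ^ 2 := lintegral_mul_cutoff_le_setLIntegral_ball _ y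
      _ ≤ (volume (ball (0 : (EuclideanSpace ℝ (Fin 3))) 1))⁻¹ * (2 * (α : ℝ≥0∞) * volume (ball (0 : (EuclideanSpace ℝ (Fin 3))) (4 + 1))) :=
          setLIntegral_ball_le_of_forall_unitBall (hm₀.enorm.pow_const 2) hα y 4
      _ = 2 * N * α := by rw [hN]; ring
      _ = ((2 * n₅ * α : ℝ≥0) : ℝ≥0∞) := by rw [← hn₅N]; push_cast; ring
  -- ## the core estimate at the thresholds `θ_m = 8 n₅ α + 1/(m+1)`
  have hcore : ∀ m : ℕ,
      (∀ᵐ t ∂(volume.restrict (Ioo 0 T)), ∀ z : (EuclideanSpace ℝ (Fin 3)),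
        ∫⁻ x in ball z 1, ‖u t x‖ₑ ^ 2 ≤ ((8 * n₅ * α + 1 / (m + 1) : ℝ≥0) : ℝ≥0∞)) ∧
      ∀ z : (EuclideanSpace ℝ (Fin 3)), ∫⁻ w in Ioo 0 T ×ˢ ball z 1, ENNReal.ofReal (frobeniusNormSq (G w.1 w.2)) ≤
        (((8 * n₅ * α + 1 / (m + 1)) / 2 : ℝ≥0) : ℝ≥0∞) := by
    intro m
    set η : ℝ≥0 := 1 / (m + 1) with hη
    have hηpos : 0 < η := by rw [hη]; positivity
    have hη1 : η ≤ 1 := by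
      rw [hη, div_le_iff₀ (by positivity), one_mul]
      exact le_add_self
    set θ : ℝ≥0 := 8 * n₅ * α + η with hθ
    have hθpos : 0 < θ := by rw [hθ]; positivity
    refine core_bounds_slab hv hm₀ hG (hK hvm0 hπm0 hcube hG) cg hcgm hcgL hcgdec hcgfin hT hTsl hT1 hθpos ?_ ?_
    · -- smallness of the time
      intro s hs0 hsT
      set σ : ℝ≥0 := ⟨s ^ (1 / 4 : ℝ), Real.rpow_nonneg hs0 _⟩ with hσ
      have hσs : (σ : ℝ) ^ 4 = s := by
        show (s ^ (1 / 4 : ℝ)) ^ 4 = s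
        rw [← Real.rpow_natCast, ← Real.rpow_mul hs0]; norm_num
      rw [show s = (σ : ℝ) ^ 4 from hσs.symm, window_bound_cast, ENNReal.coe_le_coe]
      obtain ⟨h1, h2⟩ := small_hyps K₁ K₂ n₅ α η ε₀ σ hη1 hs0 hsT hσs hTε hTα hε1 hε2
      exact window_bound_le_quarter K₁ K₂ θ σ h1 h2
    · -- size of the datum
      intro y
      refine (ha0 y).trans (ENNReal.coe_le_coe.2 ?_)
      rw [hθ, ← NNReal.coe_le_coe]
      push_cast
      linarith [η.coe_nonneg]
  -- ## `η → 0`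
  have hE : ∀ᵐ t ∂(volume.restrict (Ioo 0 T)), ∀ z : (EuclideanSpace ℝ (Fin 3)),
      ∫⁻ x in ball z 1, ‖u t x‖ₑ ^ 2 ≤ ((8 * n₅ * α : ℝ≥0) : ℝ≥0∞) := by
    have h := ae_all_iff.2 fun m => (hcore m).1
    filter_upwards [h] with t ht z
    refine ENNReal.le_of_forall_pos_le_add fun ε hε _ => ?_
    obtain ⟨m, hm⟩ := exists_nat_one_div_lt hε
    calc ∫⁻ x in ball z 1, ‖u t x‖ₑ ^ 2 ≤ ((8 * n₅ * α + 1 / (m + 1) : ℝ≥0) : ℝ≥0∞) := ht m z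
      _ = ((8 * n₅ * α : ℝ≥0) : ℝ≥0∞) + ((1 / (m + 1) : ℝ≥0) : ℝ≥0∞) := ENNReal.coe_add _ _
      _ ≤ ((8 * n₅ * α : ℝ≥0) : ℝ≥0∞) + ε := by gcongr
  have hD : ∀ z : (EuclideanSpace ℝ (Fin 3)), ∫⁻ w in Ioo 0 T ×ˢ ball z 1, ENNReal.ofReal (frobeniusNormSq (G w.1 w.2)) ≤
      ((4 * n₅ * α : ℝ≥0) : ℝ≥0∞) := by
    intro z
    refine ENNReal.le_of_forall_pos_le_add fun ε hε _ => ?_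
    obtain ⟨m, hm⟩ := exists_nat_one_div_lt hε
    calc ∫⁻ w in Ioo 0 T ×ˢ ball z 1, ENNReal.ofReal (frobeniusNormSq (G w.1 w.2))
        ≤ (((8 * n₅ * α + 1 / (m + 1)) / 2 : ℝ≥0) : ℝ≥0∞) := (hcore m).2 z
      _ ≤ ((4 * n₅ * α : ℝ≥0) : ℝ≥0∞) + ((1 / (m + 1) : ℝ≥0) : ℝ≥0∞) := by
          rw [← ENNReal.coe_add, ENNReal.coe_le_coe, ← NNReal.coe_le_coe]
          push_cast
          have : (0 : ℝ) ≤ 1 / (m + 1) := by positivity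
          linarith
      _ ≤ ((4 * n₅ * α : ℝ≥0) : ℝ≥0∞) + ε := by gcongr
  -- ## the constants of the statement
  have hC1 : 4 * n₅ ≤ C := le_max_left _ _
  have hC2 : 24 * P₀ * (n₅ * NNReal.sqrt n₅) ≤ C := le_max_right _ _
  refine ⟨?_, fun x₀ => ?_, fun x₀ => ?_⟩
  · filter_upwards [hE] with t ht x₀
    refine (ht x₀).trans ?_
    rw [show (2 : ℝ≥0∞) = ((2 : ℝ≥0) : ℝ≥0∞) from rfl, ← ENNReal.coe_mul, ENNReal.coe_le_coe]
    calc 8 * n₅ * α = 2 * (4 * n₅ * α) := by ring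
      _ ≤ 2 * (C * α) := by gcongr
  · refine (hD x₀).trans (ENNReal.coe_le_coe.2 ?_)
    calc 4 * n₅ * α = (4 * n₅) * α := by ring
      _ ≤ C * α := by gcongr
  · -- the pressure at the centre `x₀`, gauge `c_{x₀}`
    refine ⟨cg x₀, hcgm x₀, ?_⟩
    have hM : ((8 * n₅ * α : ℝ≥0) : ℝ≥0∞) ≠ ⊤ := ENNReal.coe_ne_top
    have hDM : ((4 * n₅ * α : ℝ≥0) : ℝ≥0∞) ≤ ((8 * n₅ * α : ℝ≥0) : ℝ≥0∞) := by
      refine ENNReal.coe_le_coe.2 ?_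
      calc 4 * n₅ * α ≤ 4 * n₅ * α + 4 * n₅ * α := le_self_add
        _ = 8 * n₅ * α := by ring
    have h := hP hvm0 hπm0 hcube hG le_rfl hT.le hTsl (by linarith) x₀
      ((hcgm x₀).aestronglyMeasurable) (hcgdec x₀) hM le_rfl hDM hE hD
    rw [sub_zero] at h
    calc ∫⁻ z in Ioo 0 T ×ˢ ball x₀ 1, ‖p z.1 z.2 - cg x₀ z.1‖ₑ ^ (3 / 2 : ℝ)
        ≤ ∫⁻ z in Ioo 0 T ×ˢ ball x₀ 3, ‖p z.1 z.2 - cg x₀ z.1‖ₑ ^ (3 / 2 : ℝ) :=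
          lintegral_mono_set (Set.prod_mono Subset.rfl (ball_subset_ball (by norm_num)))
      _ ≤ (P₀ : ℝ≥0∞) * ((8 * n₅ * α : ℝ≥0) : ℝ≥0∞) ^ (3 / 2 : ℝ) * ENNReal.ofReal T ^ (1 / 4 : ℝ) := h
      _ ≤ (P₀ : ℝ≥0∞) * ((8 * n₅ * α : ℝ≥0) : ℝ≥0∞) ^ (3 / 2 : ℝ) * 1 := by
          gcongr
          exact ENNReal.rpow_le_one (ENNReal.ofReal_le_one.2 hT1') (by norm_num)
      _ = ((P₀ * (8 * n₅ * α * NNReal.sqrt (8 * n₅ * α)) : ℝ≥0) : ℝ≥0∞) := by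
          rw [mul_one, coe_rpow_threeHalves, ← ENNReal.coe_mul]
      _ ≤ ((C * (α * NNReal.sqrt α) : ℝ≥0) : ℝ≥0∞) := by
          refine ENNReal.coe_le_coe.2 ?_
          calc P₀ * (8 * n₅ * α * NNReal.sqrt (8 * n₅ * α))
              ≤ P₀ * (24 * (n₅ * NNReal.sqrt n₅) * (α * NNReal.sqrt α)) :=
                mul_le_mul_of_nonneg_left (eight_mul_threeHalves_le n₅ α) (by simp)
            _ = (24 * P₀ * (n₅ * NNReal.sqrt n₅)) * (α * NNReal.sqrt α) := by ring
            _ ≤ C * (α * NNReal.sqrt α) := by gcongr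


end JiaSverak2014

end Literature.Analysis.FluidPDE

end
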